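import Mathlib

/-!
# GRW transformation algebra — Giorgi–Klainerman–Szeftel, *Kerr stability for small angular
momentum*, Chapter 5 §5.2–§5.3 and Appendix D.3–D.4 (with the Chapter 3 Kerr value tables
they consume)

CITATION HEADER.
* Primary source `[J]`: E. Giorgi, S. Klainerman, J. Szeftel, *Wave equations estimates and
  the nonlinear stability of slowly rotating Kerr black holes* / *Kerr stability for small
  angular momentum*, Pure Appl. Math. Q. **20** (2024), doi 10.4310/pamq.241128023033
  (bib key `GiorgiKlainermanSzeftel2024`).  A locus `[J] p.N Lm` is book page `N`, line `m` of
  the per-page text layer of the published PDF.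
* Beside it `[v1]`: arXiv:2205.14808v1, TeX source `FinalKerrarxivversion.tex`
  (bib key `GiorgiKlainermanSzeftel2022`); a locus `[v1] l.N` is a TeX line number.
* Numbering: `[v1]` Definition 5.3.3 / Proposition 5.3.4 / Theorem 5.3.6 are `[J]`
  Definition 5.3.4 / Proposition 5.3.5 / Theorem 5.3.7; `[v1]` Proposition `prop:potential-real`,
  Lemma `lemma:squaref-1f`, Theorem `main-theorem-intermediate` are `[J]` Proposition D.4.5,
  Lemma D.4.6, Theorem D.4.7.  Chapter 3 and §5.2 numbers agree.
* Caveat on loci.  The text layer of `[J]` drops the under-bar accent (so `tr χ` and `tr χ̲`,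
  `η` and `η̲` print alike there); every placement of bars below was read on the `[v1]` TeX
  source and the `[J]` locus is given for position only.  Where `[v1]` and `[J]` differ in
  substance this is recorded under DIVERGENCE.

WHAT IS TRANSCRIBED.  The displayed *scalar* algebra by which `[J]` passes from the Teukolsky
variables `A`, `A̲` to the generalized Regge–Wheeler (gRW) quantities `𝔮`, `𝔮̲`
(Chandrasekhar-type transformation), namely
* §0 the dictionary: `|q|² = r² + a² cos²θ`, `Δ = r² − 2mr + a²`, `q = r + i a cos θ`, the
  Kerr values of `tr χ, ⁽ᵃ⁾tr χ, tr χ̲, ⁽ᵃ⁾tr χ̲, tr X, tr X̲, η, η̲, ρ, *ρ, P, H, Z, 𝔍, ω, ω̲` in the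
  outgoing and ingoing principal null frames (`[J]` §3.3, pp.122–127), the scalars `C₁, C₂`
  of `[J]` (5.2.3) and `C̲₁, C̲₂` of `[J]` (5.3.3) (same formula, evaluated on `(tr χ̲, ⁽ᵃ⁾tr χ̲)`
  resp. `(tr χ, ⁽ᵃ⁾tr χ)`), the potential `V` of `[J]` Theorems 5.2.9/5.3.7, and the
  quantities `V₁, Z₄₃, Z₂₃` of `[J]` Proposition D.4.5;
* §1 consistency identities among the printed value tables (`[J]` (3.4.2), Lemma 3.4.1,
  (3.4.5), Lemma 3.4.4, `P = ρ + i *ρ`, `tr X = tr χ − i ⁽ᵃ⁾tr χ`, `ω = −½∂ᵣ(Δ/|q|²)`);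
* §2 the transport ("null structure") values used as "Recall, in Kerr" steps in `[J]` D.3,
  the proof of Proposition 5.3.5 and D.4 (`e₃(tr χ̲) = −½(tr χ̲² − ⁽ᵃ⁾tr χ̲²)` etc.), and the
  transport lines of `[J]` Lemma D.4.6;
* §3 the frame-independent expansions of `[J]` D.3: `r∇₃(r²∇₃(r f A))` and `r²∇₃∇₃(r² f A)`
  over an abstract covariant derivative, the coefficient identities defining `I₁, I₂`
  (`[J]` (D.3.2)), the reduction `I₂ = ½(∇₃I₁ + ½I₁²)` and the `(x, y)`-lemma
  `∇(C₁) + ½C₁² = 2C₂` under `∇x = −½(x² − y²)`, `∇y = −xy`;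
* §4 the Kerr computation of `[J]` D.3 in the ingoing frame (`e₃ f₁`, `e₃ f₂`, `e₃ f`,
  `I₁ = C₁`, `I₂ = C₂`, `r⁴f = (q̄/q)·q q̄³`) and `[J]` Proposition 5.2.4, (5.2.6)–(5.2.7);
* §5 `[J]` Lemma 5.2.6 with its footnote and the substitution of `[J]` Proposition 5.2.5;
* §6 the outgoing computation in the proof of `[J]` Proposition 5.3.5 and (5.3.4)–(5.3.5);
* §7 the potential: `[J]` Remark 5.2.11 (`a = 0`), the chain of displayed equalities of
  `[J]` pp.855–856 computing `V₁`, the evaluations of `Z₄₃`, `Z₂₃`, `ℜZ₁₃ = 0`, the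
  coefficients `8a²Δ/(r²|q|⁴)`, `8aΔ/(r²|q|⁴)` of `L_𝔮` (`[J]` p.862, Theorem 5.2.9) and the
  final `V = V₁ + (|q|²/Δ) Z₄₃` (`[J]` p.862 L90ff).

WHAT IS CERTIFIED.  Identities in an arbitrary field `K` of characteristic zero.  The frame
derivatives `e₃`, `e₄` act on the scalars involved (functions of `r, θ` only) through
`∂ᵣ`, so they are modelled by a derivation `D : Derivation ℤ K K` with the printed values
`D r = ±1`, `D r = ∓Δ/|q|²` (`[J]` (3.3.2), p.126) and `D a = D m = D (cos θ) = 0`; the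
horizontal derivative `e₁ = |q|⁻¹∂_θ` is modelled by a derivation `E` with `E (cos θ) = −sin θ`,
`E (sin θ) = cos θ`, `E r = 0`.  The imaginary unit is an element `i` with `i² = −1`, and
`|q|` is an element `n` with `n² = r² + a²cos²θ`; complex conjugates are written out
(`q̄ = r − i a cos θ`).  The second-order operator identities of §3–§6 are stated over an
abstract additive operator `∇` on a `K`-module satisfying the Leibniz rule
`∇(f•u) = (Df)•u + f•∇u` (structure `CovD`), which is all the displayed manipulations use.
Proofs are `field_simp`/`ring`/`module` computations; nothing is assumed beyond the printed
values, and every non-degeneracy hypothesis (`r ≠ 0`, `|q|² ≠ 0`, …) is explicit.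

PRINT DATA (slips located while certifying; all NIL-class: they do not propagate to `C₁`,
`C₂`, `V`, `V₁`, `Z₄₃`, `Z₂₃`, which are certified as printed).
* PD1 `[J]` p.820 L5–13 = `[v1]` l.33697: "i.e. `e₃f = (4a²cos²θ/(r|q|²) − i ⁽ᵃ⁾tr χ̲) f`";
  the preceding line (and the truth, `e3_f_in`) has `− 2i ⁽ᵃ⁾tr χ̲`.
* PD2 `[J]` p.819 L39–52 = `[v1]` l.33672–33680: the two displays
  "`I₂ = ∇₃(e₃f − 2r⁻¹f) + … = ½∇₃(f I₁) − r⁻¹ f I₁`" hold for `f I₂`, not `I₂`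
  (`fI2_in_rewrite`); and `[J]` p.820 L61–66 = `[v1]` l.33714 "`I₂ = ½ f (∇₃I₁ + ½I₁²)`"
  carries a stray factor `f` (`I2_via_I1_in`).  The two slips cancel: `I₂ = C₂` is correct.
* PD3 `[J]` p.821 L37 = `[v1]` l.33737: in "`2(tr χ̲² + ⁽ᵃ⁾tr χ̲⁴/tr χ̲² − 4⁽ᵃ⁾tr χ̲² − 2 ⁽ᵃ⁾tr χ² …)`"
  the term `−2 ⁽ᵃ⁾tr χ²` should be under-barred (`sq_half_C1`).
* PD4 `[J]` p.821 L48 = `[v1]` l.33738: last term "`+ 8i tr χ̲ ⁽ᵃ⁾tr χ̲`" should read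
  `+ 8i ⁽ᵃ⁾tr χ̲³/tr χ̲` (`C1_to_C2`).
* PD5 `[J]` p.199 L60–90 = `[v1]` l.9147: first line of the display for `I₁`,
  "`2(−4a²cos²θ/(r|q|²) + 2r/|q|² − 2i ⁽ᵃ⁾tr χ)`", should have `2/r` in place of `2r/|q|²`;
  the second line is correct (`I1_out_lines`).
* PD6 cosmetic: `[J]` p.820 L119 = `[v1]` l.33727 "`∇̌₃E₁`" for `∇₃I₁`; `[v1]` l.33678 stray
  indices `A₁₁`; `[J]` p.124 L80/L102 = `[v1]` l.5622–5631 Definition 3.3.3 "`e₃⁽ⁱⁿ⁾(r) = 1`"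
  against (3.3.2) `e₃⁽ⁱⁿ⁾(r) = −1` (`[J]` p.122 L57).

DIVERGENCE `[v1]` → `[J]`.
* DV1 `[v1]` l.8907 (Remark after Theorem 5.2.9): "`V₀ = −tr χ tr χ̲ = 4Δ/((r²+a²)|q|²)`";
  `[J]` Remark 5.2.11 (p.194 L20–27) prints instead the Schwarzschild value
  `V₀ = −tr χ tr χ̲ = (4/r²)(1 − 2m/r)`.  In Kerr `−tr χ tr χ̲ = 4r²Δ/|q|⁶` in both principal
  frames (`neg_trch_trchb_out/in`), which differs from the `[v1]` expression by
  `4a²Δ(r²(2cos²θ−1) + a²cos⁴θ)/((r²+a²)|q|⁶)` (`V0v1_sub`); all three agree at `a = 0`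
  (`Vpot_a_zero`, `V0v1_a_zero`).

NOT CLAIMED.  No statement about tensors, spinor/frame geometry, the wave operators `□₂`,
the error terms `Err[…]`, the `O(·)` / `Γ_b, Γ_g` bookkeeping, or any estimate; the null
structure and Bianchi equations are *not* derived — only the printed Kerr values are checked
against each other and differentiated.  `[J]` Lemma 5.2.1, Propositions 5.2.8, 5.3.1,
Lemma 5.3.3/5.3.6, D.1–D.2, D.4.1–D.4.4 and D.5–D.6 are not transcribed.

STATUS-RELATION.  Independent of the other modules of this directory (no import); the scalars
`C1`, `C2`, `trXO`, `trXbI` here are the abstract-field versions of the `ℝ → ℂ` functions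
`Cb1`, `Cb2`, `trX`, `trXb` of `AbarDecayInteriorLedger` (same printed formulas (5.3.3),
(12.1.4)).
-/


namespace Literature.Geometry.Lorentzian.GiorgiKlainermanSzeftel2022.GRWTransformationAlgebra

variable {K : Type*} [Field K]

/-! ## §0. Dictionary: the printed Kerr values -/

/-- `|q|² = r² + a² cos² θ`, as a function of `r, a, c = cos θ`.
[cite: GiorgiKlainermanSzeftel2024, (3.1.1) and §3.3, p.122; GiorgiKlainermanSzeftel2022, l.5474] -/
def nsq (r a c : K) : K := r ^ 2 + a ^ 2 * c ^ 2

/-- `Δ = r² − 2mr + a²`. [cite: GiorgiKlainermanSzeftel2024, §3.3, p.122; GiorgiKlainermanSzeftel2022, l.5474–5487] -/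
def Del (r a m : K) : K := r ^ 2 - 2 * m * r + a ^ 2

/-- `q = r + i a cos θ`. [cite: GiorgiKlainermanSzeftel2024, (3.1.1), Lemma 3.4.1 p.130 L9; GiorgiKlainermanSzeftel2022, l.5922] -/
def qq (i r a c : K) : K := r + i * a * c

/-- `q̄ = r − i a cos θ` (complex conjugate of `q`, written out). [folklore] -/
def qb (i r a c : K) : K := r - i * a * c

/-- Outgoing frame: `tr χ = 2r/|q|²`. [cite: GiorgiKlainermanSzeftel2024, §3.3.2 p.126 L130–139; GiorgiKlainermanSzeftel2022, l.5728–5733] -/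
def trchO (r a c : K) : K := 2 * r / nsq r a c

/-- Outgoing frame: `⁽ᵃ⁾tr χ = 2a cos θ/|q|²`. [cite: GiorgiKlainermanSzeftel2024, p.126 L138; GiorgiKlainermanSzeftel2022, l.5728–5733] -/
def atrchO (r a c : K) : K := 2 * a * c / nsq r a c

/-- Outgoing frame: `tr χ̲ = −2rΔ/|q|⁴`. [cite: GiorgiKlainermanSzeftel2024, p.126 L139; GiorgiKlainermanSzeftel2022, l.5728–5733] -/
def trchbO (r a m c : K) : K := -(2 * r * Del r a m) / nsq r a c ^ 2

/-- Outgoing frame: `⁽ᵃ⁾tr χ̲ = 2aΔ cos θ/|q|⁴`. [cite: GiorgiKlainermanSzeftel2024, p.126 L139; GiorgiKlainermanSzeftel2022, l.5728–5733] -/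
def atrchbO (r a m c : K) : K := 2 * a * Del r a m * c / nsq r a c ^ 2

/-- Outgoing frame: `ω̲ = (a²cos²θ(r − m) + mr² − a²r)/|q|⁴`.
[cite: GiorgiKlainermanSzeftel2024, p.126 L151; GiorgiKlainermanSzeftel2022, l.5734–5735] -/
def ombO (r a m c : K) : K := (a ^ 2 * c ^ 2 * (r - m) + m * r ^ 2 - a ^ 2 * r) / nsq r a c ^ 2

/-- Outgoing frame: `tr X = 2/q`. [cite: GiorgiKlainermanSzeftel2024, p.127 L5–20; GiorgiKlainermanSzeftel2022, l.5740–5744] -/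
def trXO (i r a c : K) : K := 2 / qq i r a c

/-- Outgoing frame: `tr X̲ = −2Δq/|q|⁴`. [cite: GiorgiKlainermanSzeftel2024, p.127 L5–20; GiorgiKlainermanSzeftel2022, l.5740–5744] -/
def trXbO (i r a m c : K) : K := -(2 * Del r a m * qq i r a c) / nsq r a c ^ 2

/-- Outgoing frame: `H₁ = a q i sin θ/|q|³`. [cite: GiorgiKlainermanSzeftel2024, p.127 L5–26; GiorgiKlainermanSzeftel2022, l.5740–5747] -/
def H1O (i r a c s n : K) : K := a * qq i r a c * i * s / n ^ 3

/-- Outgoing frame: `H₂ = a q sin θ/|q|³`. [cite: GiorgiKlainermanSzeftel2024, p.127 L5–26; GiorgiKlainermanSzeftel2022, l.5740–5747] -/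
def H2O (i r a c s n : K) : K := a * qq i r a c * s / n ^ 3

/-- Outgoing frame: `Z₁ = a q̄ i sin θ/|q|³` (and `H̲ = −Z`). [cite: GiorgiKlainermanSzeftel2024, p.127 L5–26; GiorgiKlainermanSzeftel2022, l.5740–5747] -/
def Z1O (i r a c s n : K) : K := a * qb i r a c * i * s / n ^ 3

/-- Outgoing frame: `Z₂ = a q̄ sin θ/|q|³` (and `H̲ = −Z`). [cite: GiorgiKlainermanSzeftel2024, p.127 L5–26; GiorgiKlainermanSzeftel2022, l.5740–5747] -/
def Z2O (i r a c s n : K) : K := a * qb i r a c * s / n ^ 3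

/-- Ingoing frame: `tr χ = 2Δr/|q|⁴`. [cite: GiorgiKlainermanSzeftel2024, §3.3.1 p.123 L55–73; GiorgiKlainermanSzeftel2022, l.5596–5599] -/
def trchI (r a m c : K) : K := 2 * Del r a m * r / nsq r a c ^ 2

/-- Ingoing frame: `⁽ᵃ⁾tr χ = 2aΔ cos θ/|q|⁴`. [cite: GiorgiKlainermanSzeftel2024, p.123 L55–73; GiorgiKlainermanSzeftel2022, l.5596–5599] -/
def atrchI (r a m c : K) : K := 2 * a * Del r a m * c / nsq r a c ^ 2

/-- Ingoing frame: `tr χ̲ = −2r/|q|²`. [cite: GiorgiKlainermanSzeftel2024, p.123 L55–73; GiorgiKlainermanSzeftel2022, l.5596–5599] -/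
def trchbI (r a c : K) : K := -(2 * r) / nsq r a c

/-- Ingoing frame: `⁽ᵃ⁾tr χ̲ = 2a cos θ/|q|²`. [cite: GiorgiKlainermanSzeftel2024, p.123 L55–73; GiorgiKlainermanSzeftel2022, l.5596–5599] -/
def atrchbI (r a c : K) : K := 2 * a * c / nsq r a c

/-- Ingoing frame: `ω = −(a²cos²θ(r − m) + mr² − a²r)/|q|⁴`.
[cite: GiorgiKlainermanSzeftel2024, p.123 L76–84; GiorgiKlainermanSzeftel2022, l.5600] -/
def omI (r a m c : K) : K := -(a ^ 2 * c ^ 2 * (r - m) + m * r ^ 2 - a ^ 2 * r) / nsq r a c ^ 2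

/-- Ingoing frame: `tr X = 2Δq̄/|q|⁴`. [cite: GiorgiKlainermanSzeftel2024, p.123 L132–147; GiorgiKlainermanSzeftel2022, l.5613–5615] -/
def trXI (i r a m c : K) : K := 2 * Del r a m * qb i r a c / nsq r a c ^ 2

/-- Ingoing frame: `tr X̲ = −2/q̄`. [cite: GiorgiKlainermanSzeftel2024, p.123 L132–147; GiorgiKlainermanSzeftel2022, l.5613–5615] -/
def trXbI (i r a c : K) : K := -2 / qb i r a c

/-- `η₁ = −a² sin θ cos θ/|q|³` (both principal frames; `s = sin θ`, `n = |q|`).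
[cite: GiorgiKlainermanSzeftel2024, p.123 L86–131 and p.126 L166–189; GiorgiKlainermanSzeftel2022, l.5601–5607, l.5736–5739] -/
def eta1 (a c s n : K) : K := -(a ^ 2 * s * c) / n ^ 3

/-- `η₂ = a r sin θ/|q|³`. [cite: GiorgiKlainermanSzeftel2024, p.123 L86–131, p.126 L166–189; GiorgiKlainermanSzeftel2022, l.5601–5607] -/
def eta2 (r a s n : K) : K := a * r * s / n ^ 3

/-- `*η₁ = a r sin θ/|q|³`. [cite: GiorgiKlainermanSzeftel2024, p.123 L86–131, p.126 L166–189; GiorgiKlainermanSzeftel2022, l.5601–5607] -/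
def seta1 (r a s n : K) : K := a * r * s / n ^ 3

/-- `*η₂ = a² sin θ cos θ/|q|³`. [cite: GiorgiKlainermanSzeftel2024, p.123 L86–131, p.126 L166–189; GiorgiKlainermanSzeftel2022, l.5601–5607] -/
def seta2 (a c s n : K) : K := a ^ 2 * s * c / n ^ 3

/-- `η̲₁ = −a² sin θ cos θ/|q|³`. [cite: GiorgiKlainermanSzeftel2024, p.123 L86–131, p.126 L166–189; GiorgiKlainermanSzeftel2022, l.5601–5607] -/
def etab1 (a c s n : K) : K := -(a ^ 2 * s * c) / n ^ 3

/-- `η̲₂ = −a r sin θ/|q|³`. [cite: GiorgiKlainermanSzeftel2024, p.123 L86–131, p.126 L166–189; GiorgiKlainermanSzeftel2022, l.5601–5607] -/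
def etab2 (r a s n : K) : K := -(a * r * s) / n ^ 3

/-- `*η̲₁ = −a r sin θ/|q|³`. [cite: GiorgiKlainermanSzeftel2024, p.123 L86–131, p.126 L166–189; GiorgiKlainermanSzeftel2022, l.5601–5607] -/
def setab1 (r a s n : K) : K := -(a * r * s) / n ^ 3

/-- `*η̲₂ = a² sin θ cos θ/|q|³`. [cite: GiorgiKlainermanSzeftel2024, p.123 L86–131, p.126 L166–189; GiorgiKlainermanSzeftel2022, l.5601–5607] -/
def setab2 (a c s n : K) : K := a ^ 2 * s * c / n ^ 3

/-- `ρ = −2m(r³ − 3ra²cos²θ)/|q|⁶` (any principal frame).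
[cite: GiorgiKlainermanSzeftel2024, p.124 L5–11; GiorgiKlainermanSzeftel2022, l.5619–5622] -/
def rho (r a m c : K) : K := -(2 * m * (r ^ 3 - 3 * r * a ^ 2 * c ^ 2)) / nsq r a c ^ 3

/-- `*ρ = 2am cos θ(3r² − a²cos²θ)/|q|⁶`. [cite: GiorgiKlainermanSzeftel2024, p.124 L5–11; GiorgiKlainermanSzeftel2022, l.5619–5622] -/
def srho (r a m c : K) : K := 2 * a * m * c * (3 * r ^ 2 - a ^ 2 * c ^ 2) / nsq r a c ^ 3

/-- `P = −2m/q³`. [cite: GiorgiKlainermanSzeftel2024, p.124 L12–15; GiorgiKlainermanSzeftel2022, l.5619–5622] -/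
def PP (i r a m c : K) : K := -(2 * m) / qq i r a c ^ 3

/-- `𝔍₁ = i sin θ/|q|`. [cite: GiorgiKlainermanSzeftel2024, Definition 3.4.2 p.130 L48; GiorgiKlainermanSzeftel2022, l.5969] -/
def J1 (i s n : K) : K := i * s / n

/-- `𝔍₂ = sin θ/|q|`. [cite: GiorgiKlainermanSzeftel2024, Definition 3.4.2 p.130 L48; GiorgiKlainermanSzeftel2022, l.5969] -/
def J2 (s n : K) : K := s / n

/-- `Λ = (r² + a²) cot θ/|q|³`, the coefficient in `div ξ = e₁(ξ₁) + Λ ξ₁`, `curl ξ = e₁(ξ₂) + Λ ξ₂`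
for `t, φ`-independent horizontal 1-forms in the canonical basis.
[cite: GiorgiKlainermanSzeftel2024, (3.3.11)–(3.3.12) p.125 L37–117; GiorgiKlainermanSzeftel2022, l.5647–5666] -/
def Lam (r a c s n : K) : K := (r ^ 2 + a ^ 2) * c / (s * n ^ 3)

/-- `C₁(x, y) = 2x − 2y²/x − 4iy`; `[J]` (5.2.3) is `C₁ = C1 (tr χ̲) (⁽ᵃ⁾tr χ̲)` and `[J]` (5.3.3) is
`C̲₁ = C1 (tr χ) (⁽ᵃ⁾tr χ)`.
[cite: GiorgiKlainermanSzeftel2024, (5.2.3) p.190 L26–45 and (5.3.3) p.198 L74; GiorgiKlainermanSzeftel2022, l.8711, l.9103] -/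
def C1 (i x y : K) : K := 2 * x - 2 * (y ^ 2 / x) - 4 * i * y

/-- `C₂(x, y) = ½x² − 4y² + (3/2)y⁴/x² + i(−2xy + 4y³/x)`; `[J]` (5.2.3)/(5.3.3).
[cite: GiorgiKlainermanSzeftel2024, (5.2.3) p.190 L34–45 and (5.3.3) p.198 L74; GiorgiKlainermanSzeftel2022, l.8712, l.9104] -/
def C2 (i x y : K) : K :=
  1 / 2 * x ^ 2 - 4 * y ^ 2 + 3 / 2 * (y ^ 4 / x ^ 2) + i * (-2 * x * y + 4 * (y ^ 3 / x))

/-- `I₁ = 2f⁻¹(e₃f − 2r⁻¹f)` (ingoing sign). [cite: GiorgiKlainermanSzeftel2024, (D.3.2) p.819 L35–52; GiorgiKlainermanSzeftel2022, l.33666] -/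
def I1in (D : Derivation ℤ K K) (r f : K) : K := 2 * f⁻¹ * (D f - 2 * r⁻¹ * f)

/-- `I₂ = f⁻¹(∇₃e₃f − 4r⁻¹e₃f + 2r⁻²f)` (ingoing sign). [cite: GiorgiKlainermanSzeftel2024, (D.3.2) p.819 L38; GiorgiKlainermanSzeftel2022, l.33667] -/
def I2in (D : Derivation ℤ K K) (r f : K) : K := f⁻¹ * (D (D f) - 4 * r⁻¹ * D f + 2 * (r ^ 2)⁻¹ * f)

/-- `I₁ = 2f⁻¹(e₄f + 2r⁻¹f)` (outgoing sign). [cite: GiorgiKlainermanSzeftel2024, proof of Proposition 5.3.5 p.199 L45–60; GiorgiKlainermanSzeftel2022, l.9136] -/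
def I1out (D : Derivation ℤ K K) (r f : K) : K := 2 * f⁻¹ * (D f + 2 * r⁻¹ * f)

/-- `I₂ = f⁻¹(∇₄e₄f + 4r⁻¹e₄f + 2r⁻²f)` (outgoing sign). [cite: GiorgiKlainermanSzeftel2024, p.199 L45–60; GiorgiKlainermanSzeftel2022, l.9137] -/
def I2out (D : Derivation ℤ K K) (r f : K) : K := f⁻¹ * (D (D f) + 4 * r⁻¹ * D f + 2 * (r ^ 2)⁻¹ * f)

/-- The potential of `[J]` Theorems 5.2.9 and 5.3.7:
`V = (4/|q|²)(r² − 2mr + 2a²)/r² − (4a²cos²θ/|q|⁶)(r² + 6mr + a²cos²θ)`.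
[cite: GiorgiKlainermanSzeftel2024, (5.2.12) p.193 L30–37 and (5.3.9) p.200 L82; GiorgiKlainermanSzeftel2022, l.8865, l.9198, l.35244] -/
def Vpot (r a m c : K) : K :=
  4 / nsq r a c * ((r ^ 2 - 2 * m * r + 2 * a ^ 2) / r ^ 2)
    - 4 * a ^ 2 * c ^ 2 / nsq r a c ^ 3 * (r ^ 2 + 6 * m * r + a ^ 2 * c ^ 2)

/-- `V₁` of `[J]` Proposition D.4.5 (item 2, outgoing frame).
[cite: GiorgiKlainermanSzeftel2024, Proposition D.4.5 p.851 L13–19 and p.856 L62–65; GiorgiKlainermanSzeftel2022, l.34840–34841] -/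
def V1pot (r a m c : K) : K :=
  4 / nsq r a c * ((r ^ 2 - 2 * m * r + 2 * a ^ 2) / r ^ 2)
    - 4 * a ^ 2 * c ^ 2 / (r ^ 2 * nsq r a c ^ 3)
      * (2 * r ^ 4 + 4 * m * r ^ 3 + a ^ 2 * r ^ 2 + 2 * a ^ 2 * c ^ 2 * r ^ 2
          - 2 * m * r * a ^ 2 * c ^ 2 + a ^ 4 * c ^ 2)

/-- `Z₄₃ = 4a²Δ²cos²θ/(r²|q|⁶)` of `[J]` Proposition D.4.5.
[cite: GiorgiKlainermanSzeftel2024, p.851 and Theorem D.4.7 p.861 L49; GiorgiKlainermanSzeftel2022, l.34842] -/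
def Z43 (r a m c : K) : K := 4 * a ^ 2 * Del r a m ^ 2 * c ^ 2 / (r ^ 2 * nsq r a c ^ 3)

/-- `Z₂₃ = 8a sin θ Δ/|q|⁵` of `[J]` Proposition D.4.5.
[cite: GiorgiKlainermanSzeftel2024, p.851 and Theorem D.4.7 p.861 L55; GiorgiKlainermanSzeftel2022, l.34843] -/
def Z23 (r a m s n : K) : K := 8 * a * s * Del r a m / n ^ 5

/-- The printed Kerr value of `div η̲ = e₁(η̲₁) + Λη̲₁`.
[cite: GiorgiKlainermanSzeftel2024, p.856 L48–60; GiorgiKlainermanSzeftel2022, l.34995] -/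
def divEtab (r a c : K) : K :=
  ((-3 * c ^ 2 + 1) * a ^ 2 * r ^ 2 + a ^ 4 * c ^ 2 * (-3 + c ^ 2)) / nsq r a c ^ 3

/-- The printed Kerr value of `curl η̲ = e₁(η̲₂) + Λη̲₂`.
[cite: GiorgiKlainermanSzeftel2024, p.856 L48–60; GiorgiKlainermanSzeftel2022, l.34996] -/
def curlEtab (r a c : K) : K :=
  a * c / nsq r a c ^ 3 * (-2 * r ^ 3 + 2 * a ^ 2 * c ^ 2 * r - 4 * a ^ 2 * r)

/-- The `[v1]`-only expression `V₀ = 4Δ/((r² + a²)|q|²)` of the remark after `[v1]` Theorem 5.2.9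
(replaced in `[J]` Remark 5.2.11; see DIVERGENCE DV1). [cite: GiorgiKlainermanSzeftel2022, l.8907] -/
def V0v1 (r a m c : K) : K := 4 * Del r a m / ((r ^ 2 + a ^ 2) * nsq r a c)

/-- An abstract covariant derivative along one frame direction: an additive operator on a
`K`-module obeying the Leibniz rule with respect to the scalar derivation `D`.  This is the only
property of `∇₃`, `∇₄` used in the displayed expansions of `[J]` D.3. [folklore] -/
structure CovD (D : Derivation ℤ K K) (M : Type*) [AddCommGroup M] [Module K M] where
  /-- the operator `∇` -/
  op : M →+ M
  /-- Leibniz rule `∇(f•u) = (Df)•u + f•∇u` -/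
  leibniz : ∀ (f : K) (u : M), op (f • u) = D f • u + f • op u

/-- `𝔮`-shaped expression `w · (∇∇A + C₁∇A + C₂A)`; `[J]` (5.2.2) is the case `w = q q̄³`,
`[J]` (5.3.2) the case `w = q̄ q³`.
[cite: GiorgiKlainermanSzeftel2024, (5.2.2) p.190 L17–21, (5.3.2) p.198 L45–49; GiorgiKlainermanSzeftel2022, l.8706, l.9098] -/
def qfrak {D : Derivation ℤ K K} {M : Type*} [AddCommGroup M] [Module K M] (nab : CovD D M)
    (w C1v C2v : K) (A : M) : M :=
  w • (nab.op (nab.op A) + C1v • nab.op A + C2v • A)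

/-! ### Auxiliary algebra -/

/-- Powers of an element with `i² = −1`. [folklore] -/
theorem ipow (i : K) (hi : i ^ 2 = -1) :
    i ^ 3 = -i ∧ i ^ 4 = 1 ∧ i ^ 5 = i ∧ i ^ 6 = -1 ∧ i ^ 7 = -i ∧ i ^ 8 = 1 := by
  refine ⟨?_, ?_, ?_, ?_, ?_, ?_⟩
  · linear_combination i * hi
  · linear_combination (i ^ 2 - 1) * hi
  · linear_combination (i ^ 3 - i) * hi
  · linear_combination (i ^ 4 - i ^ 2 + 1) * hi
  · linear_combination (i ^ 5 - i ^ 3 + i) * hi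
  · linear_combination (i ^ 6 - i ^ 4 + i ^ 2 - 1) * hi

/-- Powers of an element with prescribed square (used for `n = |q|` and `s = sin θ`). [folklore] -/
theorem sqpow (n N : K) (hn : n ^ 2 = N) :
    n ^ 3 = N * n ∧ n ^ 4 = N ^ 2 ∧ n ^ 5 = N ^ 2 * n ∧ n ^ 6 = N ^ 3 ∧ n ^ 7 = N ^ 3 * n ∧
    n ^ 8 = N ^ 4 ∧ n ^ 9 = N ^ 4 * n ∧ n ^ 10 = N ^ 5 ∧ n ^ 11 = N ^ 5 * n ∧ n ^ 12 = N ^ 6 ∧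
    n ^ 13 = N ^ 6 * n ∧ n ^ 14 = N ^ 7 ∧ n ^ 15 = N ^ 7 * n ∧ n ^ 16 = N ^ 8 ∧
    n ^ 17 = N ^ 8 * n ∧ n ^ 18 = N ^ 9 := by
  subst hn; refine ⟨?_, ?_, ?_, ?_, ?_, ?_, ?_, ?_, ?_, ?_, ?_, ?_, ?_, ?_, ?_, ?_⟩ <;> ring

/-- A derivation kills numerals. [folklore] -/
theorem D_ofNat (D : Derivation ℤ K K) (k : ℕ) [k.AtLeastTwo] : D (OfNat.ofNat k : K) = 0 := by
  rw [← Nat.cast_ofNat]; exact D.map_natCast _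

/-- The numerals met below. [folklore] -/
theorem D_num (D : Derivation ℤ K K) :
    D (2 : K) = 0 ∧ D (3 : K) = 0 ∧ D (4 : K) = 0 ∧ D (6 : K) = 0 ∧ D (8 : K) = 0 := by
  refine ⟨D_ofNat D 2, D_ofNat D 3, D_ofNat D 4, D_ofNat D 6, D_ofNat D 8⟩

/-- `|q|² = q q̄`. [folklore] -/
theorem nsq_eq_qq_mul_qb (i r a c : K) (hi : i ^ 2 = -1) : nsq r a c = qq i r a c * qb i r a c := by
  unfold qq qb nsq; linear_combination (a ^ 2 * c ^ 2) * hi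

/-- `q ≠ 0` once `|q|² ≠ 0`. [folklore] -/
theorem qq_ne_zero (i r a c : K) (hi : i ^ 2 = -1) (hN : nsq r a c ≠ 0) : qq i r a c ≠ 0 := by
  intro h; apply hN; rw [nsq_eq_qq_mul_qb i r a c hi, h, zero_mul]

/-- `q̄ ≠ 0` once `|q|² ≠ 0`. [folklore] -/
theorem qb_ne_zero (i r a c : K) (hi : i ^ 2 = -1) (hN : nsq r a c ≠ 0) : qb i r a c ≠ 0 := by
  intro h; apply hN; rw [nsq_eq_qq_mul_qb i r a c hi, h, mul_zero]

/-- `|q|² ≠ 0` once `|q| ≠ 0`. [folklore] -/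
theorem nsq_ne_zero_of_sq (r a c n : K) (hn : n ^ 2 = nsq r a c) (hn0 : n ≠ 0) : nsq r a c ≠ 0 := by
  rw [← hn]; exact pow_ne_zero 2 hn0

/-- `∂_θ|q| = −a² cos θ sin θ/|q|` from `|q|² = r² + a²cos²θ`. [folklore] -/
theorem E_absq [CharZero K] (E : Derivation ℤ K K) (r a c s n : K) (hn : n ^ 2 = nsq r a c)
    (hn0 : n ≠ 0) (hEr : E r = 0) (hEa : E a = 0) (hEc : E c = -s) :
    E n = -(a ^ 2 * c * s) / n := by
  have h : E (n ^ 2) = E (nsq r a c) := by rw [hn]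
  unfold nsq at h
  simp only [map_add, E.leibniz, E.leibniz_pow, hEr, hEa, hEc, smul_eq_mul, nsmul_eq_mul,
    Nat.cast_ofNat, mul_zero, add_zero, zero_add, smul_zero] at h
  rw [eq_div_iff hn0]
  ring_nf at h ⊢
  linear_combination (1 / 2 : K) * h

section Identities

variable [CharZero K]

/-! ## §1. Consistency of the printed value tables (`[J]` §3.3–§3.4) -/

/-- Outgoing: `tr X = tr χ − i ⁽ᵃ⁾tr χ` on the printed values `2/q`, `2r/|q|²`, `2a cos θ/|q|²`.
[cite: GiorgiKlainermanSzeftel2024, p.127 L5–20 with p.126 L138; GiorgiKlainermanSzeftel2022, l.5740–5744] -/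
theorem trX_out (i r a c : K) (hi : i ^ 2 = -1) (hN : nsq r a c ≠ 0) :
    trXO i r a c = trchO r a c - i * atrchO r a c := by
  obtain ⟨i3, i4, i5, i6, i7, i8⟩ := ipow i hi
  have hq := qq_ne_zero i r a c hi hN
  unfold trXO trchO atrchO qq nsq at *
  field_simp
  (try ring_nf); (try simp only [hi]); (try ring_nf)

omit [CharZero K] in
/-- Outgoing: `tr X̲ = tr χ̲ − i ⁽ᵃ⁾tr χ̲` on the printed values.
[cite: GiorgiKlainermanSzeftel2024, p.127 L5–20 with p.126 L139; GiorgiKlainermanSzeftel2022, l.5740–5744] -/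
theorem trXb_out (i r a m c : K) : trXbO i r a m c = trchbO r a m c - i * atrchbO r a m c := by
  unfold trXbO trchbO atrchbO qq
  ring

omit [CharZero K] in
/-- Ingoing: `tr X = tr χ − i ⁽ᵃ⁾tr χ` on the printed values.
[cite: GiorgiKlainermanSzeftel2024, p.123 L55–147; GiorgiKlainermanSzeftel2022, l.5596–5615] -/
theorem trX_in (i r a m c : K) : trXI i r a m c = trchI r a m c - i * atrchI r a m c := by
  unfold trXI trchI atrchI qb
  ring

/-- Ingoing: `tr X̲ = tr χ̲ − i ⁽ᵃ⁾tr χ̲` on the printed values `−2/q̄`, `−2r/|q|²`, `2a cos θ/|q|²`.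
[cite: GiorgiKlainermanSzeftel2024, p.123 L55–147; GiorgiKlainermanSzeftel2022, l.5596–5615] -/
theorem trXb_in (i r a c : K) (hi : i ^ 2 = -1) (hN : nsq r a c ≠ 0) :
    trXbI i r a c = trchbI r a c - i * atrchbI r a c := by
  obtain ⟨i3, i4, i5, i6, i7, i8⟩ := ipow i hi
  have hqb := qb_ne_zero i r a c hi hN
  unfold trXbI trchbI atrchbI qb nsq at *
  field_simp
  (try ring_nf); (try simp only [hi]); (try ring_nf)

omit [CharZero K] in
/-- `[J]` (3.4.2), first relation, outgoing frame: `tr χ ⁽ᵃ⁾tr χ̲ + tr χ̲ ⁽ᵃ⁾tr χ = 0`.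
[cite: GiorgiKlainermanSzeftel2024, (3.4.2) p.128 L145–150; GiorgiKlainermanSzeftel2022, l.5861–5877] -/
theorem id342a_out (r a m c : K) :
    trchO r a c * atrchbO r a m c + trchbO r a m c * atrchO r a c = 0 := by
  unfold trchO atrchbO trchbO atrchO
  ring

omit [CharZero K] in
/-- `[J]` (3.4.2), first relation, ingoing frame.
[cite: GiorgiKlainermanSzeftel2024, (3.4.2) p.128 L145–150; GiorgiKlainermanSzeftel2022, l.5861–5877] -/
theorem id342a_in (r a m c : K) :
    trchI r a m c * atrchbI r a c + trchbI r a c * atrchI r a m c = 0 := by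
  unfold trchI atrchbI trchbI atrchI
  ring

omit [CharZero K] in
/-- `[J]` (3.4.2), second relation: `|η|² − |η̲|² = 0` on the printed components.
[cite: GiorgiKlainermanSzeftel2024, (3.4.2) p.128 L146; GiorgiKlainermanSzeftel2022, l.5861–5877] -/
theorem id342b (r a c s n : K) :
    eta1 a c s n ^ 2 + eta2 r a s n ^ 2 - (etab1 a c s n ^ 2 + etab2 r a s n ^ 2) = 0 := by
  unfold eta1 eta2 etab1 etab2
  ring

/-- `P = ρ + i *ρ` on the printed values `−2m/q³`, `ρ`, `*ρ`.
[cite: GiorgiKlainermanSzeftel2024, p.124 L5–15; GiorgiKlainermanSzeftel2022, l.5619–5622] -/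
theorem P_eq_rho (i r a m c : K) (hi : i ^ 2 = -1) (hN : nsq r a c ≠ 0) :
    PP i r a m c = rho r a m c + i * srho r a m c := by
  obtain ⟨i3, i4, i5, i6, i7, i8⟩ := ipow i hi
  have hq := qq_ne_zero i r a c hi hN
  unfold PP rho srho qq nsq at *
  field_simp
  (try ring_nf); (try simp only [hi, i3, i4]); (try ring_nf)

omit [CharZero K] in
/-- Outgoing: `H = η + i *η`, first component, on the printed values.
[cite: GiorgiKlainermanSzeftel2024, p.127 L5–26 with p.126 L166–189; GiorgiKlainermanSzeftel2022, l.5736–5747] -/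
theorem H1_out (i r a c s n : K) (hi : i ^ 2 = -1) :
    H1O i r a c s n = eta1 a c s n + i * seta1 r a s n := by
  unfold H1O eta1 seta1 qq
  linear_combination (a ^ 2 * c * s / n ^ 3) * hi

omit [CharZero K] in
/-- Outgoing: `H = η + i *η`, second component. [cite: GiorgiKlainermanSzeftel2024, p.127 L5–26; GiorgiKlainermanSzeftel2022, l.5736–5747] -/
theorem H2_out (i r a c s n : K) : H2O i r a c s n = eta2 r a s n + i * seta2 a c s n := by
  unfold H2O eta2 seta2 qq
  ring

omit [CharZero K] in
/-- Outgoing: `H̲ = −Z = η̲ + i *η̲`, first component. [cite: GiorgiKlainermanSzeftel2024, p.127 L26; GiorgiKlainermanSzeftel2022, l.5736–5747] -/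
theorem Z1_out (i r a c s n : K) (hi : i ^ 2 = -1) :
    -Z1O i r a c s n = etab1 a c s n + i * setab1 r a s n := by
  unfold Z1O etab1 setab1 qb
  linear_combination (a ^ 2 * c * s / n ^ 3) * hi

omit [CharZero K] in
/-- Outgoing: `H̲ = −Z = η̲ + i *η̲`, second component. [cite: GiorgiKlainermanSzeftel2024, p.127 L26; GiorgiKlainermanSzeftel2022, l.5736–5747] -/
theorem Z2_out (i r a c s n : K) : -Z2O i r a c s n = etab2 r a s n + i * setab2 a c s n := by
  unfold Z2O etab2 setab2 qb
  ring

omit [CharZero K] in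
/-- `[J]` (3.4.5), outgoing frame: `H̲ = −(a q̄/|q|²) 𝔍` and `H = (a q/|q|²) 𝔍`, componentwise.
[cite: GiorgiKlainermanSzeftel2024, (3.4.5) p.131 L14–27; GiorgiKlainermanSzeftel2022, l.5989] -/
theorem H_via_J_out (i r a c s n : K) (hn : n ^ 2 = nsq r a c) (hn0 : n ≠ 0) :
    (-Z1O i r a c s n = -(a * qb i r a c / nsq r a c) * J1 i s n ∧
      -Z2O i r a c s n = -(a * qb i r a c / nsq r a c) * J2 s n) ∧
    (H1O i r a c s n = a * qq i r a c / nsq r a c * J1 i s n ∧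
      H2O i r a c s n = a * qq i r a c / nsq r a c * J2 s n) := by
  unfold Z1O Z2O H1O H2O J1 J2
  rw [← hn]
  refine ⟨⟨?_, ?_⟩, ⟨?_, ?_⟩⟩ <;> field_simp

omit [CharZero K] in
/-- `[J]` Lemma 3.4.4: `*𝔍 = −i𝔍` (with `(*ξ)₁ = ξ₂`, `(*ξ)₂ = −ξ₁`), `𝔍·𝔍̄ = 2 sin²θ/|q|²`,
`|ℜ𝔍|² = sin²θ/|q|²`.
[cite: GiorgiKlainermanSzeftel2024, Lemma 3.4.4 p.131 L32–47; GiorgiKlainermanSzeftel2022, l.6002] -/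
theorem J_identities (i s n : K) (hi : i ^ 2 = -1) :
    (J2 s n = -i * J1 i s n ∧ -J1 i s n = -i * J2 s n) ∧
    J1 i s n * (-i * s / n) + J2 s n * (s / n) = 2 * s ^ 2 / n ^ 2 ∧
    J2 s n ^ 2 = s ^ 2 / n ^ 2 := by
  unfold J1 J2
  refine ⟨⟨?_, ?_⟩, ?_, ?_⟩
  · linear_combination (s / n) * hi
  · ring
  · linear_combination (-(s ^ 2 / n ^ 2)) * hi
  · ring

/-- Ingoing: `ω = −½ ∂ᵣ(Δ/|q|²)` equals the printed closed form (`D = ∂ᵣ`).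
[cite: GiorgiKlainermanSzeftel2024, p.123 L76–84; GiorgiKlainermanSzeftel2022, l.5600] -/
theorem om_in (D : Derivation ℤ K K) (r a m c : K) (hN : nsq r a c ≠ 0) (hDr : D r = 1)
    (hDa : D a = 0) (hDm : D m = 0) (hDc : D c = 0) :
    omI r a m c = -(1 / 2) * D (Del r a m / nsq r a c) := by
  obtain ⟨D2, D3, D4, D6, D8⟩ := D_num D
  unfold omI Del nsq at *
  simp only [map_add, map_sub, D.leibniz, D.leibniz_pow, D.leibniz_div,
    hDr, hDa, hDm, hDc, D2, smul_eq_mul, nsmul_eq_mul, Nat.cast_ofNat, mul_zero,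
    add_zero, mul_one, smul_zero]
  field_simp
  ring

/-- Outgoing: `ω̲ = ½ ∂ᵣ(Δ/|q|²)` equals the printed closed form (`D = ∂ᵣ`).
[cite: GiorgiKlainermanSzeftel2024, p.126 L151; GiorgiKlainermanSzeftel2022, l.5734–5735] -/
theorem omb_out (D : Derivation ℤ K K) (r a m c : K) (hN : nsq r a c ≠ 0) (hDr : D r = 1)
    (hDa : D a = 0) (hDm : D m = 0) (hDc : D c = 0) :
    ombO r a m c = 1 / 2 * D (Del r a m / nsq r a c) := by
  obtain ⟨D2, D3, D4, D6, D8⟩ := D_num D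
  unfold ombO Del nsq at *
  simp only [map_add, map_sub, D.leibniz, D.leibniz_pow, D.leibniz_div,
    hDr, hDa, hDm, hDc, D2, smul_eq_mul, nsmul_eq_mul, Nat.cast_ofNat, mul_zero,
    add_zero, mul_one, smul_zero]
  field_simp
  ring

/-! ## §2. Transport values used in the displayed computations -/

/-- `[J]` Lemma 3.4.1, `∇₄q = ½ tr X q`, outgoing frame (`e₄(r) = 1`, `e₄(cos θ) = 0`).
[cite: GiorgiKlainermanSzeftel2024, Lemma 3.4.1 p.130 L6–16; GiorgiKlainermanSzeftel2022, l.5927] -/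
theorem nabla4_q_out (D : Derivation ℤ K K) (i r a c : K) (hi : i ^ 2 = -1) (hN : nsq r a c ≠ 0)
    (hDr : D r = 1) (hDa : D a = 0) (hDc : D c = 0) (hDi : D i = 0) :
    D (qq i r a c) = 1 / 2 * trXO i r a c * qq i r a c := by
  have hq := qq_ne_zero i r a c hi hN
  unfold trXO
  unfold qq at *
  simp only [map_add, D.leibniz, hDr, hDa, hDc, hDi, smul_eq_mul, mul_zero, add_zero]
  field_simp

/-- `[J]` Lemma 3.4.1, `∇₃q = ½ conj(tr X̲) q`, outgoing frame (`e₃(r) = −Δ/|q|²`), with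
`conj(tr X̲) = −2Δq̄/|q|⁴`. [cite: GiorgiKlainermanSzeftel2024, Lemma 3.4.1 p.130 L6–16, (3.3.2)/p.126; GiorgiKlainermanSzeftel2022, l.5927, l.5680–5686] -/
theorem nabla3_q_out (D : Derivation ℤ K K) (i r a m c : K) (hi : i ^ 2 = -1) (hN : nsq r a c ≠ 0)
    (hDr : D r = -(Del r a m / nsq r a c)) (hDa : D a = 0) (hDc : D c = 0) (hDi : D i = 0) :
    D (qq i r a c) = 1 / 2 * (-(2 * Del r a m * qb i r a c) / nsq r a c ^ 2) * qq i r a c := by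
  rw [nsq_eq_qq_mul_qb i r a c hi] at hN hDr ⊢
  have hq : qq i r a c ≠ 0 := left_ne_zero_of_mul hN
  have hqb : qb i r a c ≠ 0 := right_ne_zero_of_mul hN
  have e : D (qq i r a c) = D r := by
    unfold qq; simp only [map_add, D.leibniz, hDa, hDc, hDi, smul_eq_mul, mul_zero, add_zero]
  rw [e, hDr]
  field_simp

/-- `[J]` Lemma 3.4.1, `∇₄q = ½ tr X q`, ingoing frame (`e₄(r) = Δ/|q|²`).
[cite: GiorgiKlainermanSzeftel2024, Lemma 3.4.1 p.130, (3.3.2) p.122 L46–59; GiorgiKlainermanSzeftel2022, l.5927, l.5480–5482] -/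
theorem nabla4_q_in (D : Derivation ℤ K K) (i r a m c : K) (hi : i ^ 2 = -1) (hN : nsq r a c ≠ 0)
    (hDr : D r = Del r a m / nsq r a c) (hDa : D a = 0) (hDc : D c = 0) (hDi : D i = 0) :
    D (qq i r a c) = 1 / 2 * trXI i r a m c * qq i r a c := by
  unfold trXI
  rw [nsq_eq_qq_mul_qb i r a c hi] at hN hDr ⊢
  have hq : qq i r a c ≠ 0 := left_ne_zero_of_mul hN
  have hqb : qb i r a c ≠ 0 := right_ne_zero_of_mul hN
  have e : D (qq i r a c) = D r := by
    unfold qq; simp only [map_add, D.leibniz, hDa, hDc, hDi, smul_eq_mul, mul_zero, add_zero]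
  rw [e, hDr]
  field_simp

/-- `[J]` Lemma 3.4.1, `∇₃q = ½ conj(tr X̲) q`, ingoing frame (`e₃(r) = −1`), with `conj(tr X̲) = −2/q`.
[cite: GiorgiKlainermanSzeftel2024, Lemma 3.4.1 p.130, (3.3.2) p.122 L57; GiorgiKlainermanSzeftel2022, l.5927, l.5480–5482] -/
theorem nabla3_q_in (D : Derivation ℤ K K) (i r a c : K) (hi : i ^ 2 = -1) (hN : nsq r a c ≠ 0)
    (hDr : D r = -1) (hDa : D a = 0) (hDc : D c = 0) (hDi : D i = 0) :
    D (qq i r a c) = 1 / 2 * (-2 / qq i r a c) * qq i r a c := by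
  have hq := qq_ne_zero i r a c hi hN
  have e : D (qq i r a c) = D r := by
    unfold qq; simp only [map_add, D.leibniz, hDa, hDc, hDi, smul_eq_mul, mul_zero, add_zero]
  rw [e, hDr]
  field_simp

omit [CharZero K] in
/-- `[J]` Lemma 3.4.1, `q H̲ = −q̄ H` (outgoing, `H̲ = −Z`), componentwise on the printed values.
[cite: GiorgiKlainermanSzeftel2024, Lemma 3.4.1 p.130 L13; GiorgiKlainermanSzeftel2022, l.5930] -/
theorem q_Hb_out (i r a c s n : K) :
    qq i r a c * (-Z1O i r a c s n) = -(qb i r a c * H1O i r a c s n) ∧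
    qq i r a c * (-Z2O i r a c s n) = -(qb i r a c * H2O i r a c s n) := by
  unfold Z1O Z2O H1O H2O
  constructor <;> ring

omit [CharZero K] in
/-- `[J]` Lemma 3.4.1: `|H|² = |H̲|²`, i.e. `|η|² + |*η|² = |η̲|² + |*η̲|²` on the printed components.
[cite: GiorgiKlainermanSzeftel2024, Lemma 3.4.1 p.130 L18; GiorgiKlainermanSzeftel2022, l.5933] -/
theorem H_norm_eq (r a c s n : K) :
    eta1 a c s n ^ 2 + eta2 r a s n ^ 2 + seta1 r a s n ^ 2 + seta2 a c s n ^ 2 =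
      etab1 a c s n ^ 2 + etab2 r a s n ^ 2 + setab1 r a s n ^ 2 + setab2 a c s n ^ 2 := by
  unfold eta1 eta2 seta1 seta2 etab1 etab2 setab1 setab2
  ring

omit [CharZero K] in
/-- `[J]` Lemma 3.4.1, `𝒟q = q H̲` (outgoing, `H̲ = −Z`): with `e₂(q) = 0`, `(𝒟q)₁ = e₁(q)` and
`(𝒟q)₂ = −i e₁(q)`, `e₁ = |q|⁻¹∂_θ` (`E = ∂_θ`).
[cite: GiorgiKlainermanSzeftel2024, Lemma 3.4.1 p.130 L9–39; GiorgiKlainermanSzeftel2022, l.5928, l.5946–5953] -/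
theorem calD_q_out (E : Derivation ℤ K K) (i r a c s n : K) (hi : i ^ 2 = -1) (hn : n ^ 2 = nsq r a c)
    (hn0 : n ≠ 0) (hEr : E r = 0) (hEa : E a = 0) (hEc : E c = -s) (hEi : E i = 0) :
    1 / n * E (qq i r a c) = qq i r a c * (-Z1O i r a c s n) ∧
    -i * (1 / n * E (qq i r a c)) = qq i r a c * (-Z2O i r a c s n) := by
  obtain ⟨n3, n4, n5, n6, n7, n8, -⟩ := sqpow n _ hn
  obtain ⟨i3, i4, -⟩ := ipow i hi
  have e : E (qq i r a c) = -(i * a * s) := by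
    unfold qq
    simp only [map_add, E.leibniz, hEr, hEa, hEc, hEi, smul_eq_mul, mul_zero, add_zero, zero_add,
      mul_neg]
  rw [e]
  unfold Z1O Z2O qq qb
  unfold nsq at *
  constructor
  · field_simp
    (try ring_nf); (try simp only [hn, i3]); (try ring_nf)
  · field_simp
    (try ring_nf); (try simp only [hn, hi]); (try ring_nf)

/-- `[J]` Lemma 3.4.4: `𝒟q = −a𝔍`, componentwise (`e₁ = |q|⁻¹∂_θ`, `e₂(q) = 0`).
[cite: GiorgiKlainermanSzeftel2024, Lemma 3.4.4 p.131 L72–75; GiorgiKlainermanSzeftel2022, l.6019] -/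
theorem calD_q_J (E : Derivation ℤ K K) (i r a c s n : K) (hi : i ^ 2 = -1)
    (hEr : E r = 0) (hEa : E a = 0) (hEc : E c = -s) (hEi : E i = 0) :
    1 / n * E (qq i r a c) = -a * J1 i s n ∧ -i * (1 / n * E (qq i r a c)) = -a * J2 s n := by
  have e : E (qq i r a c) = -(i * a * s) := by
    unfold qq
    simp only [map_add, E.leibniz, hEr, hEa, hEc, hEi, smul_eq_mul, mul_zero, add_zero, zero_add,
      mul_neg]
  rw [e]
  unfold J1 J2
  constructor
  · ring
  · linear_combination (a * s / n) * hi

/-- `[J]` Lemma 3.4.1: `∇(|q|²) = (η + η̲)|q|²`, componentwise: `e₁(|q|²) = (η₁ + η̲₁)|q|²` and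
`0 = e₂(|q|²) = (η₂ + η̲₂)|q|²`.
[cite: GiorgiKlainermanSzeftel2024, Lemma 3.4.1 p.130 L13; GiorgiKlainermanSzeftel2022, l.5929] -/
theorem grad_absq (E : Derivation ℤ K K) (r a c s n : K) (hn : n ^ 2 = nsq r a c) (hn0 : n ≠ 0)
    (hEr : E r = 0) (hEa : E a = 0) (hEc : E c = -s) :
    1 / n * E (n ^ 2) = (eta1 a c s n + etab1 a c s n) * n ^ 2 ∧
      eta2 r a s n + etab2 r a s n = 0 := by
  have hEn := E_absq E r a c s n hn hn0 hEr hEa hEc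
  constructor
  · rw [E.leibniz_pow, hEn]
    unfold eta1 etab1
    simp only [nsmul_eq_mul, smul_eq_mul, Nat.cast_ofNat]
    field_simp
    ring
  · unfold eta2 etab2; ring

/-- The `θ`-derivative content of `[J]` Lemma 3.4.4, `𝒟̄·𝔍 = 4i(r² + a²)cos θ/|q|⁴`:
`e₁(𝔍₂) + Λ 𝔍₂ = 2(r² + a²)cos θ/|q|⁴` (`= curl ℜ𝔍`).
[cite: GiorgiKlainermanSzeftel2024, Lemma 3.4.4 p.131 L62–67, (3.3.11)–(3.3.12) p.125; GiorgiKlainermanSzeftel2022, l.6015, l.5647–5666] -/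
theorem curl_ReJ (E : Derivation ℤ K K) (r a c s n : K) (hn : n ^ 2 = nsq r a c) (hn0 : n ≠ 0)
    (hs0 : s ≠ 0) (hsc : s ^ 2 + c ^ 2 = 1) (hEr : E r = 0) (hEa : E a = 0) (hEc : E c = -s)
    (hEs : E s = c) :
    1 / n * E (J2 s n) + Lam r a c s n * J2 s n = 2 * (r ^ 2 + a ^ 2) * c / nsq r a c ^ 2 := by
  have hEn := E_absq E r a c s n hn hn0 hEr hEa hEc
  have hs2 : s ^ 2 = 1 - c ^ 2 := by linear_combination hsc
  have h4 : n ^ 4 = nsq r a c ^ 2 := by rw [← hn]; ring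
  have key : E (J2 s n) = (n * c - s * (-(a ^ 2 * c * s) / n)) / n ^ 2 := by
    unfold J2; rw [E.leibniz_div, hEs, hEn]; simp only [smul_eq_mul]; field_simp
  calc 1 / n * E (J2 s n) + Lam r a c s n * J2 s n
      = (c * n ^ 2 + a ^ 2 * c * s ^ 2 + (r ^ 2 + a ^ 2) * c) / n ^ 4 := by
        rw [key]; unfold Lam J2; field_simp; ring
    _ = 2 * (r ^ 2 + a ^ 2) * c / nsq r a c ^ 2 := by
        rw [h4, hn, hs2]; unfold nsq; ring

omit [CharZero K] in
/-- Outgoing, `e₄(r) = 1`: the reduced equation `∇₄ tr X + ½(tr X)² = 0` holds on `tr X = 2/q`.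
[cite: GiorgiKlainermanSzeftel2024, proof of Lemma 3.4.1 p.130 L19–20; GiorgiKlainermanSzeftel2022, l.5939] -/
theorem e4_trX_out (D : Derivation ℤ K K) (i r a c : K) (hi : i ^ 2 = -1) (hN : nsq r a c ≠ 0)
    (hDr : D r = 1) (hDa : D a = 0) (hDc : D c = 0) (hDi : D i = 0) :
    D (trXO i r a c) + 1 / 2 * trXO i r a c ^ 2 = 0 := by
  obtain ⟨D2, -⟩ := D_num D
  have hq := qq_ne_zero i r a c hi hN
  unfold trXO
  unfold qq at *
  simp only [map_add, D.leibniz, D.leibniz_div, hDr, hDa, hDc, hDi, D2, smul_eq_mul, mul_zero,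
    add_zero, mul_one]
  field_simp
  ring

/-- Outgoing, `e₄ = ∂ᵣ`: `e₄(tr χ) = −½(tr χ² − ⁽ᵃ⁾tr χ²)` on the printed values ("Recall, in Kerr").
[cite: GiorgiKlainermanSzeftel2024, proof of Proposition 5.3.5 p.199 L100–118 (via "see the proof of Proposition 5.2.4", p.820 L82–90); GiorgiKlainermanSzeftel2022, l.9151, l.33723] -/
theorem e4_trch_out (D : Derivation ℤ K K) (r a c : K) (hN : nsq r a c ≠ 0) (hDr : D r = 1)
    (hDa : D a = 0) (hDc : D c = 0) :
    D (trchO r a c) = -(1 / 2) * (trchO r a c ^ 2 - atrchO r a c ^ 2) := by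
  obtain ⟨D2, -⟩ := D_num D
  unfold trchO atrchO
  unfold nsq at *
  simp only [map_add, D.leibniz, D.leibniz_pow, D.leibniz_div, hDr, hDa, hDc, D2, smul_eq_mul,
    nsmul_eq_mul, Nat.cast_ofNat, mul_zero, add_zero, mul_one, smul_zero]
  field_simp
  ring

omit [CharZero K] in
/-- Outgoing, `e₄ = ∂ᵣ`: `e₄(⁽ᵃ⁾tr χ) = −tr χ ⁽ᵃ⁾tr χ` on the printed values.
[cite: GiorgiKlainermanSzeftel2024, p.199 L100–118, p.820 L82–90; GiorgiKlainermanSzeftel2022, l.9151, l.33723] -/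
theorem e4_atrch_out (D : Derivation ℤ K K) (r a c : K) (hN : nsq r a c ≠ 0) (hDr : D r = 1)
    (hDa : D a = 0) (hDc : D c = 0) :
    D (atrchO r a c) = -(trchO r a c * atrchO r a c) := by
  obtain ⟨D2, -⟩ := D_num D
  unfold trchO atrchO
  unfold nsq at *
  simp only [map_add, D.leibniz, D.leibniz_pow, D.leibniz_div, hDr, hDa, hDc, D2, smul_eq_mul,
    nsmul_eq_mul, Nat.cast_ofNat, mul_zero, add_zero, mul_one, smul_zero]
  field_simp
  ring

/-- Outgoing, `e₄ = ∂ᵣ` (so `ω = 0`): the value of `e₄(tr χ̲)` used in `[J]` p.855 L31ff,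
`e₄ tr χ̲ = −½ tr χ tr χ̲ + ½ ⁽ᵃ⁾tr χ ⁽ᵃ⁾tr χ̲ + 2 div η̲ + 2|η̲|² + 2ρ`, on the printed values.
[cite: GiorgiKlainermanSzeftel2024, p.855 L31–45; GiorgiKlainermanSzeftel2022, l.34976–34978] -/
theorem e4_trchb_out (D : Derivation ℤ K K) (r a m c s n : K) (hn : n ^ 2 = nsq r a c) (hn0 : n ≠ 0)
    (hsc : s ^ 2 + c ^ 2 = 1) (hDr : D r = 1) (hDa : D a = 0) (hDm : D m = 0) (hDc : D c = 0) :
    D (trchbO r a m c) = -(1 / 2) * trchO r a c * trchbO r a m c + 1 / 2 * atrchO r a c * atrchbO r a m c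
      + 2 * divEtab r a c + 2 * (etab1 a c s n ^ 2 + etab2 r a s n ^ 2) + 2 * rho r a m c := by
  obtain ⟨D2, -⟩ := D_num D
  have hs2 : s ^ 2 = 1 - c ^ 2 := by linear_combination hsc
  obtain ⟨n3, n4, n5, n6, n7, n8, n9, n10, n11, n12, -⟩ := sqpow n _ hn
  have hN := nsq_ne_zero_of_sq r a c n hn hn0
  unfold trchbO trchO atrchO atrchbO divEtab etab1 etab2 rho Del
  unfold nsq at *
  simp only [map_add, map_sub, map_neg, D.leibniz, D.leibniz_pow, D.leibniz_div, hDr, hDa, hDm, hDc,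
    D2, smul_eq_mul, nsmul_eq_mul, Nat.cast_ofNat, mul_zero, add_zero, mul_one,
    smul_zero]
  field_simp
  (try ring_nf); (try simp only [n6, hs2]); (try ring_nf)

/-- Outgoing, `e₄ = ∂ᵣ`: `e₄ ⁽ᵃ⁾tr χ̲ = −½(tr χ ⁽ᵃ⁾tr χ̲ + ⁽ᵃ⁾tr χ tr χ̲) + 2 curl η̲ + 2 *ρ` on the printed values.
[cite: GiorgiKlainermanSzeftel2024, p.855 L31–45; GiorgiKlainermanSzeftel2022, l.34976] -/
theorem e4_atrchb_out (D : Derivation ℤ K K) (r a m c : K) (hN : nsq r a c ≠ 0)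
    (hDr : D r = 1) (hDa : D a = 0) (hDm : D m = 0) (hDc : D c = 0) :
    D (atrchbO r a m c) = -(1 / 2) * (trchO r a c * atrchbO r a m c + atrchO r a c * trchbO r a m c)
      + 2 * curlEtab r a c + 2 * srho r a m c := by
  obtain ⟨D2, -⟩ := D_num D
  unfold atrchbO trchO atrchO trchbO curlEtab srho Del
  unfold nsq at *
  simp only [map_add, map_sub, D.leibniz, D.leibniz_pow, D.leibniz_div, hDr, hDa, hDm, hDc,
    D2, smul_eq_mul, nsmul_eq_mul, Nat.cast_ofNat, mul_zero, add_zero, zero_add, mul_one,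
    smul_zero]
  field_simp
  ring

/-- Ingoing, `e₃ = −∂ᵣ` (so `ω̲ = 0`): "Recall, in Kerr, `∇₃ tr χ̲ = −½(tr χ̲² − ⁽ᵃ⁾tr χ̲²)`".
[cite: GiorgiKlainermanSzeftel2024, p.820 L82–90; GiorgiKlainermanSzeftel2022, l.33723] -/
theorem e3_trchb_in (D : Derivation ℤ K K) (r a c : K) (hN : nsq r a c ≠ 0) (hDr : D r = -1)
    (hDa : D a = 0) (hDc : D c = 0) :
    D (trchbI r a c) = -(1 / 2) * (trchbI r a c ^ 2 - atrchbI r a c ^ 2) := by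
  obtain ⟨D2, -⟩ := D_num D
  unfold trchbI atrchbI
  unfold nsq at *
  simp only [map_add, map_neg, D.leibniz, D.leibniz_pow, D.leibniz_div, hDr, hDa, hDc, D2, smul_eq_mul,
    nsmul_eq_mul, Nat.cast_ofNat, mul_zero, add_zero, mul_one, smul_zero, mul_neg]
  field_simp
  ring

omit [CharZero K] in
/-- Ingoing, `e₃ = −∂ᵣ`: "`∇₃ ⁽ᵃ⁾tr χ̲ = −tr χ̲ ⁽ᵃ⁾tr χ̲`".
[cite: GiorgiKlainermanSzeftel2024, p.820 L82–90; GiorgiKlainermanSzeftel2022, l.33723] -/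
theorem e3_atrchb_in (D : Derivation ℤ K K) (r a c : K) (hN : nsq r a c ≠ 0) (hDr : D r = -1)
    (hDa : D a = 0) (hDc : D c = 0) :
    D (atrchbI r a c) = -(trchbI r a c * atrchbI r a c) := by
  obtain ⟨D2, -⟩ := D_num D
  unfold trchbI atrchbI
  unfold nsq at *
  simp only [map_add, D.leibniz, D.leibniz_pow, D.leibniz_div, hDr, hDa, hDc, D2, smul_eq_mul,
    nsmul_eq_mul, Nat.cast_ofNat, mul_zero, add_zero, mul_one, smul_zero, mul_neg]
  field_simp
  ring

/-- `[J]` Lemma D.4.6, proof, the coefficient `½ conj(tr X̲) + (3/2) tr X̲ = 2 tr χ̲ − i ⁽ᵃ⁾tr χ̲`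
(outgoing; `conj(tr X̲) = −2Δq̄/|q|⁴`).
[cite: GiorgiKlainermanSzeftel2024, p.851 L58ff (Lemma D.4.6, proof); GiorgiKlainermanSzeftel2022, l.34862] -/
theorem lemmaD46_coeff3 (i r a m c : K) :
    1 / 2 * (-(2 * Del r a m * qb i r a c) / nsq r a c ^ 2) + 3 / 2 * trXbO i r a m c
      = 2 * trchbO r a m c - i * atrchbO r a m c := by
  unfold trXbO trchbO atrchbO qq qb
  ring

/-- `[J]` Lemma D.4.6, proof, the coefficient `½ tr X + (3/2) conj(tr X) = 2 tr χ + i ⁽ᵃ⁾tr χ`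
(outgoing; `conj(tr X) = 2/q̄`).
[cite: GiorgiKlainermanSzeftel2024, p.851 L58ff; GiorgiKlainermanSzeftel2022, l.34863] -/
theorem lemmaD46_coeff4 (i r a c : K) (hi : i ^ 2 = -1) (hN : nsq r a c ≠ 0) :
    1 / 2 * trXO i r a c + 3 / 2 * (2 / qb i r a c) = 2 * trchO r a c + i * atrchO r a c := by
  obtain ⟨i3, i4, i5, i6, i7, i8⟩ := ipow i hi
  have hq := qq_ne_zero i r a c hi hN
  have hqb := qb_ne_zero i r a c hi hN
  unfold trXO trchO atrchO qq qb nsq at *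
  field_simp
  (try ring_nf); (try simp only [hi, i3]); (try ring_nf)

/-- `[J]` Lemma D.4.6, proof: `e₄(q q̄³) = (½ tr X + (3/2) conj(tr X)) q q̄³` (outgoing, `e₄(r) = 1`).
[cite: GiorgiKlainermanSzeftel2024, p.851 L58ff; GiorgiKlainermanSzeftel2022, l.34863] -/
theorem lemmaD46_e4f (D : Derivation ℤ K K) (i r a c : K) (hi : i ^ 2 = -1) (hN : nsq r a c ≠ 0)
    (hDr : D r = 1) (hDa : D a = 0) (hDc : D c = 0) (hDi : D i = 0) :
    D (qq i r a c * qb i r a c ^ 3)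
      = (1 / 2 * trXO i r a c + 3 / 2 * (2 / qb i r a c)) * (qq i r a c * qb i r a c ^ 3) := by
  obtain ⟨D2, D3, -⟩ := D_num D
  have hq := qq_ne_zero i r a c hi hN
  have hqb := qb_ne_zero i r a c hi hN
  unfold trXO
  unfold qq qb at *
  simp only [map_add, map_sub, D.leibniz, D.leibniz_pow, hDr, hDa, hDc, hDi, smul_eq_mul, nsmul_eq_mul,
    Nat.cast_ofNat, mul_zero, add_zero, mul_one, sub_zero]
  field_simp
  ring

/-- `[J]` Lemma D.4.6, proof: `e₃(q q̄³) = (½ conj(tr X̲) + (3/2) tr X̲) q q̄³` (outgoing,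
`e₃(r) = −Δ/|q|²`). [cite: GiorgiKlainermanSzeftel2024, p.851 L58ff; GiorgiKlainermanSzeftel2022, l.34862] -/
theorem lemmaD46_e3f (D : Derivation ℤ K K) (i r a m c : K) (hi : i ^ 2 = -1) (hN : nsq r a c ≠ 0)
    (hDr : D r = -(Del r a m / nsq r a c)) (hDa : D a = 0) (hDc : D c = 0) (hDi : D i = 0) :
    D (qq i r a c * qb i r a c ^ 3)
      = (1 / 2 * (-(2 * Del r a m * qb i r a c) / nsq r a c ^ 2) + 3 / 2 * trXbO i r a m c)
          * (qq i r a c * qb i r a c ^ 3) := by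
  obtain ⟨D2, D3, -⟩ := D_num D
  unfold trXbO
  rw [nsq_eq_qq_mul_qb i r a c hi] at hN hDr ⊢
  have hq : qq i r a c ≠ 0 := left_ne_zero_of_mul hN
  have hqb : qb i r a c ≠ 0 := right_ne_zero_of_mul hN
  have e1 : D (qq i r a c) = D r := by
    unfold qq; simp only [map_add, D.leibniz, hDa, hDc, hDi, smul_eq_mul, mul_zero, add_zero]
  have e2 : D (qb i r a c) = D r := by
    unfold qb; simp only [map_sub, D.leibniz, hDa, hDc, hDi, smul_eq_mul, mul_zero, add_zero, sub_zero]
  rw [D.leibniz, D.leibniz_pow, e1, e2, hDr]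
  simp only [smul_eq_mul, nsmul_eq_mul, Nat.cast_ofNat]
  field_simp
  ring

/-- `[J]` Lemma D.4.6, proof, the coefficient of `∇f`:
`(3/2)H + ½H̄ + ½H̲ + (3/2)H̲̄ = 2(η + η̲) + i(*η − *η̲)`, componentwise with `H = η + i*η`,
`H̲ = η̲ + i*η̲`. [cite: GiorgiKlainermanSzeftel2024, p.851 L58ff; GiorgiKlainermanSzeftel2022, l.34864] -/
theorem lemmaD46_gradcoeff (i e se eb seb : K) :
    3 / 2 * (e + i * se) + 1 / 2 * (e - i * se) + 1 / 2 * (eb + i * seb) + 3 / 2 * (eb - i * seb)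
      = 2 * (e + eb) + i * (se - seb) := by
  ring

/-! ## §3. Frame-independent expansions (`[J]` D.3) -/

section CovDer

variable (D : Derivation ℤ K K) {M : Type*} [AddCommGroup M] [Module K M] (nab : CovD D M)

omit [CharZero K] in
/-- `[J]` D.3, first two displayed lines: `I = r∇₃(r²∇₃(r f A)) = r⁴f ∇₃∇₃A +
(r e₃(r³f) + r³e₃(rf))∇₃A + r∇₃(r²e₃(rf))A`.
[cite: GiorgiKlainermanSzeftel2024, p.819 L22–34; GiorgiKlainermanSzeftel2022, l.33656–33657] -/
theorem expand_I (r f : K) (A : M) :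
    r • nab.op (r ^ 2 • nab.op ((r * f) • A))
      = (r ^ 4 * f) • nab.op (nab.op A) + (r * D (r ^ 3 * f) + r ^ 3 * D (r * f)) • nab.op A
        + (r * D (r ^ 2 * D (r * f))) • A := by
  simp only [nab.leibniz, map_add, D.leibniz, D.leibniz_pow, smul_eq_mul, smul_add, smul_smul]
  module

omit [CharZero K] in
/-- `[J]` D.3, the second factorisation: `E = r²∇₃∇₃(r²f A) = r⁴f ∇₃∇₃A + 2r²e₃(r²f)∇₃A +
r²e₃e₃(r²f) A`. [cite: GiorgiKlainermanSzeftel2024, p.821 L80–90; GiorgiKlainermanSzeftel2022, l.33751–33752] -/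
theorem expand_E (r f : K) (A : M) :
    r ^ 2 • nab.op (nab.op ((r ^ 2 * f) • A))
      = (r ^ 4 * f) • nab.op (nab.op A) + (2 * r ^ 2 * D (r ^ 2 * f)) • nab.op A
        + (r ^ 2 * D (D (r ^ 2 * f))) • A := by
  simp only [nab.leibniz, map_add, D.leibniz, D.leibniz_pow, smul_eq_mul, smul_add, smul_smul]
  module

omit [CharZero K] in
/-- `[J]` D.3, third displayed line, ingoing `e₃(r) = −1`: the `∇₃A`-coefficient is `2r⁴e₃f − 4r³f`.
[cite: GiorgiKlainermanSzeftel2024, p.819 L29–34; GiorgiKlainermanSzeftel2022, l.33658] -/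
theorem coeff1_in (r f : K) (hDr : D r = -1) :
    r * D (r ^ 3 * f) + r ^ 3 * D (r * f) = 2 * r ^ 4 * D f - 4 * r ^ 3 * f := by
  simp only [D.leibniz, D.leibniz_pow, hDr, smul_eq_mul, nsmul_eq_mul, Nat.cast_ofNat]
  ring

omit [CharZero K] in
/-- `[J]` D.3, third displayed line, ingoing: the `A`-coefficient is `r⁴∇₃e₃f − 4r³e₃f + 2r²f`.
[cite: GiorgiKlainermanSzeftel2024, p.819 L29–34; GiorgiKlainermanSzeftel2022, l.33658–33659] -/
theorem coeff0_in (r f : K) (hDr : D r = -1) :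
    r * D (r ^ 2 * D (r * f)) = r ^ 4 * D (D f) - 4 * r ^ 3 * D f + 2 * r ^ 2 * f := by
  have h1 : D (r * f) = -f + r * D f := by
    rw [D.leibniz, hDr, smul_eq_mul, smul_eq_mul]; ring
  rw [h1]
  simp only [D.leibniz, D.leibniz_pow, hDr, map_add, map_neg, smul_eq_mul, nsmul_eq_mul, Nat.cast_ofNat]
  ring

omit [CharZero K] in
/-- Outgoing analogue (`e₄(r) = 1`) of `coeff1_in`: `r e₄(r³f) + r³e₄(rf) = 2r⁴e₄f + 4r³f`.
[cite: GiorgiKlainermanSzeftel2024, proof of Proposition 5.3.5 p.199 L41–60; GiorgiKlainermanSzeftel2022, l.9131–9137] -/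
theorem coeff1_out (r f : K) (hDr : D r = 1) :
    r * D (r ^ 3 * f) + r ^ 3 * D (r * f) = 2 * r ^ 4 * D f + 4 * r ^ 3 * f := by
  simp only [D.leibniz, D.leibniz_pow, hDr, smul_eq_mul, nsmul_eq_mul, Nat.cast_ofNat]
  ring

omit [CharZero K] in
/-- Outgoing analogue of `coeff0_in`: `r e₄(r²e₄(rf)) = r⁴e₄e₄f + 4r³e₄f + 2r²f`.
[cite: GiorgiKlainermanSzeftel2024, p.199 L41–60; GiorgiKlainermanSzeftel2022, l.9131–9137] -/
theorem coeff0_out (r f : K) (hDr : D r = 1) :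
    r * D (r ^ 2 * D (r * f)) = r ^ 4 * D (D f) + 4 * r ^ 3 * D f + 2 * r ^ 2 * f := by
  have h1 : D (r * f) = f + r * D f := by
    rw [D.leibniz, hDr, smul_eq_mul, smul_eq_mul]; ring
  rw [h1]
  simp only [D.leibniz, D.leibniz_pow, hDr, map_add, smul_eq_mul, nsmul_eq_mul, Nat.cast_ofNat]
  ring

omit [CharZero K] in
/-- `[J]` (D.3.2): `2r⁴e₃f − 4r³f = r⁴f·I₁`. [cite: GiorgiKlainermanSzeftel2024, (D.3.2) p.819 L35–52; GiorgiKlainermanSzeftel2022, l.33665–33666] -/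
theorem coeff1_in_I1 (r f : K) (hr : r ≠ 0) (hf : f ≠ 0) :
    2 * r ^ 4 * D f - 4 * r ^ 3 * f = r ^ 4 * f * I1in D r f := by
  unfold I1in; field_simp; ring

omit [CharZero K] in
/-- `[J]` (D.3.2): `r⁴∇₃e₃f − 4r³e₃f + 2r²f = r⁴f·I₂`. [cite: GiorgiKlainermanSzeftel2024, (D.3.2) p.819 L35–52; GiorgiKlainermanSzeftel2022, l.33665–33667] -/
theorem coeff0_in_I2 (r f : K) (hr : r ≠ 0) (hf : f ≠ 0) :
    r ^ 4 * D (D f) - 4 * r ^ 3 * D f + 2 * r ^ 2 * f = r ^ 4 * f * I2in D r f := by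
  unfold I2in; field_simp

/-- `[J]` D.3, second factorisation, ingoing: `2r²e₃(r²f) = r⁴f·I₁` (`I₁ = (2/(r²f))e₃(r²f)`).
[cite: GiorgiKlainermanSzeftel2024, p.821 L80–90; GiorgiKlainermanSzeftel2022, l.33751–33755] -/
theorem coeff1_in_I1' (r f : K) (hr : r ≠ 0) (hf : f ≠ 0) (hDr : D r = -1) :
    2 * r ^ 2 * D (r ^ 2 * f) = r ^ 4 * f * I1in D r f := by
  unfold I1in
  simp only [D.leibniz, D.leibniz_pow, hDr, smul_eq_mul, nsmul_eq_mul, Nat.cast_ofNat]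
  field_simp; ring

omit [CharZero K] in
/-- `[J]` D.3, second factorisation, ingoing: `r²e₃e₃(r²f) = r⁴f·I₂` (`I₂ = (1/(r²f))e₃e₃(r²f)`).
[cite: GiorgiKlainermanSzeftel2024, p.821 L80–90; GiorgiKlainermanSzeftel2022, l.33751–33755] -/
theorem coeff0_in_I2' (r f : K) (hr : r ≠ 0) (hf : f ≠ 0) (hDr : D r = -1) :
    r ^ 2 * D (D (r ^ 2 * f)) = r ^ 4 * f * I2in D r f := by
  obtain ⟨D2, -⟩ := D_num D
  unfold I2in
  have h1 : D (r ^ 2 * f) = -(2 * r * f) + r ^ 2 * D f := by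
    rw [D.leibniz, D.leibniz_pow, hDr]; simp only [smul_eq_mul, nsmul_eq_mul, Nat.cast_ofNat]; ring
  rw [h1]
  simp only [map_add, map_neg, D.leibniz, D.leibniz_pow, hDr, D2, smul_eq_mul, nsmul_eq_mul,
    Nat.cast_ofNat, mul_zero, add_zero]
  field_simp; ring

omit [CharZero K] in
/-- Outgoing: `2r⁴e₄f + 4r³f = r⁴f·I₁`. [cite: GiorgiKlainermanSzeftel2024, p.199 L41–60; GiorgiKlainermanSzeftel2022, l.9131–9137] -/
theorem coeff1_out_I1 (r f : K) (hr : r ≠ 0) (hf : f ≠ 0) :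
    2 * r ^ 4 * D f + 4 * r ^ 3 * f = r ^ 4 * f * I1out D r f := by
  unfold I1out; field_simp; ring

omit [CharZero K] in
/-- Outgoing: `r⁴∇₄e₄f + 4r³e₄f + 2r²f = r⁴f·I₂`. [cite: GiorgiKlainermanSzeftel2024, p.199 L41–60; GiorgiKlainermanSzeftel2022, l.9131–9137] -/
theorem coeff0_out_I2 (r f : K) (hr : r ≠ 0) (hf : f ≠ 0) :
    r ^ 4 * D (D f) + 4 * r ^ 3 * D f + 2 * r ^ 2 * f = r ^ 4 * f * I2out D r f := by
  unfold I2out; field_simp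

/-- Outgoing second factorisation: `2r²e₄(r²f) = r⁴f·I₁`. [cite: GiorgiKlainermanSzeftel2024, (5.3.5) p.199 L39–41; GiorgiKlainermanSzeftel2022, l.9121] -/
theorem coeff1_out_I1' (r f : K) (hr : r ≠ 0) (hf : f ≠ 0) (hDr : D r = 1) :
    2 * r ^ 2 * D (r ^ 2 * f) = r ^ 4 * f * I1out D r f := by
  unfold I1out
  simp only [D.leibniz, D.leibniz_pow, hDr, smul_eq_mul, nsmul_eq_mul, Nat.cast_ofNat]
  field_simp; ring

omit [CharZero K] in
/-- Outgoing second factorisation: `r²e₄e₄(r²f) = r⁴f·I₂`. [cite: GiorgiKlainermanSzeftel2024, (5.3.5) p.199 L39–41; GiorgiKlainermanSzeftel2022, l.9121] -/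
theorem coeff0_out_I2' (r f : K) (hr : r ≠ 0) (hf : f ≠ 0) (hDr : D r = 1) :
    r ^ 2 * D (D (r ^ 2 * f)) = r ^ 4 * f * I2out D r f := by
  obtain ⟨D2, -⟩ := D_num D
  unfold I2out
  have h1 : D (r ^ 2 * f) = 2 * r * f + r ^ 2 * D f := by
    rw [D.leibniz, D.leibniz_pow, hDr]; simp only [smul_eq_mul, nsmul_eq_mul, Nat.cast_ofNat]; ring
  rw [h1]
  simp only [map_add, D.leibniz, D.leibniz_pow, hDr, D2, smul_eq_mul, nsmul_eq_mul, Nat.cast_ofNat,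
    mul_zero, add_zero]
  field_simp; ring

/-- `[J]` D.3 "We rewrite `I₂` in the form …": the two displayed equalities hold for `f·I₂`
(PRINT DATUM PD2: printed with `I₂` on the left):
`f I₂ = ∇₃(e₃f − 2r⁻¹f) − 2r⁻¹(e₃f − 2r⁻¹f) = ½∇₃(f I₁) − r⁻¹ f I₁` (ingoing, `e₃(r) = −1`).
[cite: GiorgiKlainermanSzeftel2024, p.819 L39–52; GiorgiKlainermanSzeftel2022, l.33672–33680] -/
theorem fI2_in_rewrite (r f : K) (hr : r ≠ 0) (hf : f ≠ 0) (hDr : D r = -1) :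
    f * I2in D r f = D (D f - 2 * r⁻¹ * f) - 2 * r⁻¹ * (D f - 2 * r⁻¹ * f) ∧
    f * I2in D r f = 1 / 2 * D (f * I1in D r f) - r⁻¹ * (f * I1in D r f) := by
  obtain ⟨D2, -⟩ := D_num D
  have hfI : f * I1in D r f = 2 * (D f - 2 * r⁻¹ * f) := by unfold I1in; field_simp
  rw [hfI]
  unfold I2in
  simp only [map_sub, D.leibniz, D.leibniz_inv, hDr, D2, smul_eq_mul, mul_zero, add_zero]
  constructor
  · field_simp; ring
  · field_simp; ring

/-- `[J]` D.3 "Therefore `I₂ = ½ f(∇₃I₁ + ½I₁²)`" — correct without the factor `f` (PRINT DATUM PD2):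
`I₂ = ½(∇₃I₁ + ½I₁²)` for any `f ≠ 0`, ingoing `e₃(r) = −1`.
[cite: GiorgiKlainermanSzeftel2024, p.820 L61–66; GiorgiKlainermanSzeftel2022, l.33709–33714] -/
theorem I2_via_I1_in (r f : K) (hr : r ≠ 0) (hf : f ≠ 0) (hDr : D r = -1) :
    I2in D r f = 1 / 2 * (D (I1in D r f) + 1 / 2 * I1in D r f ^ 2) := by
  obtain ⟨D2, -⟩ := D_num D
  unfold I2in I1in
  simp only [map_sub, D.leibniz, D.leibniz_inv, hDr, D2, smul_eq_mul, mul_zero, add_zero]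
  field_simp
  ring

/-- Outgoing analogue: `I₂ = ½(∇₄I₁ + ½I₁²)`, `e₄(r) = 1` ("Similarly, see the proof of
Proposition 5.2.4, `I₂ = C̲₂`"). [cite: GiorgiKlainermanSzeftel2024, p.199 L118; GiorgiKlainermanSzeftel2022, l.9151] -/
theorem I2_via_I1_out (r f : K) (hr : r ≠ 0) (hf : f ≠ 0) (hDr : D r = 1) :
    I2out D r f = 1 / 2 * (D (I1out D r f) + 1 / 2 * I1out D r f ^ 2) := by
  obtain ⟨D2, -⟩ := D_num D
  unfold I2out I1out
  simp only [map_add, D.leibniz, D.leibniz_inv, hDr, D2, smul_eq_mul, mul_zero, add_zero]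
  field_simp
  ring

/-- `[J]` D.3, "Therefore, `∇₃I₁ = … = −tr χ̲² + 4 ⁽ᵃ⁾tr χ̲² + ⁽ᵃ⁾tr χ̲⁴/tr χ̲² + 4i tr χ̲ ⁽ᵃ⁾tr χ̲`":
for any derivation with `∇x = −½(x² − y²)`, `∇y = −xy`, `∇(C₁(x,y)) = −x² + 4y² + y⁴/x² + 4ixy`.
[cite: GiorgiKlainermanSzeftel2024, p.820 L92–125; GiorgiKlainermanSzeftel2022, l.33718–33730] -/
theorem D_C1 (i x y : K) (hx : x ≠ 0) (hDi : D i = 0) (hDx : D x = -(1 / 2) * (x ^ 2 - y ^ 2))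
    (hDy : D y = -(x * y)) :
    D (C1 i x y) = -x ^ 2 + 4 * y ^ 2 + y ^ 4 / x ^ 2 + 4 * i * x * y := by
  obtain ⟨D2, D3, D4, -⟩ := D_num D
  unfold C1
  simp only [map_sub, D.leibniz, D.leibniz_pow, D.leibniz_div, hDi, hDx, hDy, D2, D4,
    smul_eq_mul, nsmul_eq_mul, Nat.cast_ofNat, mul_zero, add_zero]
  field_simp
  ring

omit [CharZero K] in
/-- `[J]` D.3, the square in "Adding, simplifying …" (PRINT DATUM PD3: the printed `−2 ⁽ᵃ⁾tr χ²`
is `−2 ⁽ᵃ⁾tr χ̲²`): `(x − y²/x − 2iy)² = x² + y⁴/x² − 4y² − 2y² − 4ixy + 4iy³/x`.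
[cite: GiorgiKlainermanSzeftel2024, p.821 L5–40; GiorgiKlainermanSzeftel2022, l.33735–33737] -/
theorem sq_half_C1 (i x y : K) (hi : i ^ 2 = -1) (hx : x ≠ 0) :
    (x - y ^ 2 / x - 2 * i * y) ^ 2
      = x ^ 2 + y ^ 4 / x ^ 2 - 4 * y ^ 2 - 2 * y ^ 2 - 4 * i * x * y + 4 * i * (y ^ 3 / x) := by
  obtain ⟨i3, i4, -⟩ := ipow i hi
  field_simp
  (try ring_nf); (try simp only [hi]); (try ring_nf)

/-- `[J]` D.3, "Adding, simplifying and recalling the definition of `C₂` we deduce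
`∇₃I₁ + ½I₁² = … = tr χ̲² − 8 ⁽ᵃ⁾tr χ̲² + 3 ⁽ᵃ⁾tr χ̲⁴/tr χ̲² − 4i tr χ̲ ⁽ᵃ⁾tr χ̲ + 8i ⁽ᵃ⁾tr χ̲³/tr χ̲ = 2C₂`"
(PRINT DATUM PD4: last term printed `8i tr χ̲ ⁽ᵃ⁾tr χ̲`): for any derivation with
`∇x = −½(x² − y²)`, `∇y = −xy`.
[cite: GiorgiKlainermanSzeftel2024, p.821 L5–62; GiorgiKlainermanSzeftel2022, l.33734–33739] -/
theorem C1_to_C2 (i x y : K) (hi : i ^ 2 = -1) (hx : x ≠ 0) (hDi : D i = 0)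
    (hDx : D x = -(1 / 2) * (x ^ 2 - y ^ 2)) (hDy : D y = -(x * y)) :
    D (C1 i x y) + 1 / 2 * C1 i x y ^ 2
        = x ^ 2 - 8 * y ^ 2 + 3 * (y ^ 4 / x ^ 2) - 4 * i * x * y + 8 * i * (y ^ 3 / x) ∧
    D (C1 i x y) + 1 / 2 * C1 i x y ^ 2 = 2 * C2 i x y := by
  obtain ⟨i3, i4, i5, i6, -⟩ := ipow i hi
  rw [D_C1 D i x y hx hDi hDx hDy]
  unfold C1 C2
  constructor
  · field_simp
    (try ring_nf); (try simp only [hi]); (try ring_nf)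
  · field_simp
    (try ring_nf); (try simp only [hi]); (try ring_nf)

/-! ## §4. `[J]` D.3 in Kerr (ingoing frame, `e₃(r) = −1`) and Proposition 5.2.4 -/

omit [CharZero K] in
/-- `[J]` D.3: `e₃f₁ = (r⁴e₃|q|⁴ − |q|⁴e₃r⁴)/r⁸ = (−4r⁵|q|² + 4|q|⁴r³)/r⁸ = (4a²cos²θ/(r|q|²)) f₁`,
`f₁ = |q|⁴/r⁴`. [cite: GiorgiKlainermanSzeftel2024, p.820 L5–13 region (display before "i.e."); GiorgiKlainermanSzeftel2022, l.33685–33687] -/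
theorem e3_f1_in (r a c : K) (hr : r ≠ 0) (hDr : D r = -1) (hDa : D a = 0) (hDc : D c = 0) :
    D (nsq r a c ^ 2 / r ^ 4) = (-4 * r ^ 5 * nsq r a c + 4 * nsq r a c ^ 2 * r ^ 3) / r ^ 8 ∧
    D (nsq r a c ^ 2 / r ^ 4) = 4 * a ^ 2 * c ^ 2 / (r * nsq r a c) * (nsq r a c ^ 2 / r ^ 4) := by
  have hDn : D (nsq r a c) = -(2 * r) := by
    unfold nsq
    simp only [map_add, D.leibniz, D.leibniz_pow, hDr, hDa, hDc, smul_eq_mul, nsmul_eq_mul,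
      Nat.cast_ofNat, mul_zero, add_zero, smul_zero]
    ring
  rw [D.leibniz_div, D.leibniz_pow, D.leibniz_pow, hDn, hDr]
  simp only [smul_eq_mul, nsmul_eq_mul, Nat.cast_ofNat]
  unfold nsq at *
  constructor
  · field_simp; ring
  · field_simp; ring

omit [CharZero K] in
/-- `[J]` D.3: `e₃f₂ = −i ⁽ᵃ⁾tr χ̲ f₂`, `f₂ = q̄/q` (ingoing). [cite: GiorgiKlainermanSzeftel2024, p.820 L5–13 region; GiorgiKlainermanSzeftel2022, l.33688] -/
theorem e3_f2_in (i r a c : K) (hi : i ^ 2 = -1) (hN : nsq r a c ≠ 0) (hDr : D r = -1)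
    (hDa : D a = 0) (hDc : D c = 0) (hDi : D i = 0) :
    D (qb i r a c / qq i r a c) = -i * atrchbI r a c * (qb i r a c / qq i r a c) := by
  obtain ⟨i3, i4, -⟩ := ipow i hi
  have hq := qq_ne_zero i r a c hi hN
  have hqb := qb_ne_zero i r a c hi hN
  unfold atrchbI
  unfold qq qb nsq at *
  simp only [map_add, map_sub, D.leibniz, D.leibniz_div, hDr, hDa, hDc, hDi, smul_eq_mul, mul_zero,
    add_zero, sub_zero]
  field_simp
  (try ring_nf); (try simp only [i3]); (try ring_nf)

omit [CharZero K] in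
/-- `[J]` D.3: `e₃f = (4a²cos²θ/(r|q|²) − 2i ⁽ᵃ⁾tr χ̲) f`, `f = q̄⁴/r⁴` (ingoing).  PRINT DATUM PD1:
the repetition "i.e. `e₃f = (… − i ⁽ᵃ⁾tr χ̲) f`" drops the factor `2`.
[cite: GiorgiKlainermanSzeftel2024, p.820 L5–13; GiorgiKlainermanSzeftel2022, l.33692–33697] -/
theorem e3_f_in (i r a c : K) (hi : i ^ 2 = -1) (hr : r ≠ 0) (hN : nsq r a c ≠ 0) (hDr : D r = -1)
    (hDa : D a = 0) (hDc : D c = 0) (hDi : D i = 0) :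
    D (qb i r a c ^ 4 / r ^ 4)
      = (4 * a ^ 2 * c ^ 2 / (r * nsq r a c) - 2 * i * atrchbI r a c) * (qb i r a c ^ 4 / r ^ 4) := by
  obtain ⟨i3, i4, i5, i6, -⟩ := ipow i hi
  have hqb := qb_ne_zero i r a c hi hN
  have hDqb : D (qb i r a c) = -1 := by
    unfold qb; simp only [map_sub, D.leibniz, hDr, hDa, hDc, hDi, smul_eq_mul, mul_zero, add_zero, sub_zero]
  rw [D.leibniz_div, D.leibniz_pow, D.leibniz_pow, hDqb, hDr]
  simp only [smul_eq_mul, nsmul_eq_mul, Nat.cast_ofNat]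
  unfold atrchbI
  unfold qb nsq at *
  field_simp
  (try ring_nf); (try simp only [hi, i3, i4, i5]); (try ring_nf)

omit [CharZero K] in
/-- `f = f₁ f₂²` with `f = q̄⁴/r⁴`, `f₁ = |q|⁴/r⁴`, `f₂ = q̄/q`. [cite: GiorgiKlainermanSzeftel2024, p.819 L22–28; GiorgiKlainermanSzeftel2022, l.33652] -/
theorem f_split_in (i r a c : K) (hi : i ^ 2 = -1) (hN : nsq r a c ≠ 0) :
    qb i r a c ^ 4 / r ^ 4 = nsq r a c ^ 2 / r ^ 4 * (qb i r a c / qq i r a c) ^ 2 := by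
  have hq := qq_ne_zero i r a c hi hN
  rw [nsq_eq_qq_mul_qb i r a c hi]
  field_simp

/-- `[J]` D.3 "We deduce `I₁ = 2f⁻¹(e₃f − 2r⁻¹f) = 2(4a²cos²θ/(r|q|²) − 2i ⁽ᵃ⁾tr χ̲ − 2/r)`".
[cite: GiorgiKlainermanSzeftel2024, p.820 L15–19; GiorgiKlainermanSzeftel2022, l.33701] -/
theorem I1_in_line (i r a c : K) (hi : i ^ 2 = -1) (hr : r ≠ 0) (hN : nsq r a c ≠ 0)
    (hDr : D r = -1) (hDa : D a = 0) (hDc : D c = 0) (hDi : D i = 0) :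
    I1in D r (qb i r a c ^ 4 / r ^ 4)
      = 2 * (4 * a ^ 2 * c ^ 2 / (r * nsq r a c) - 2 * i * atrchbI r a c - 2 / r) := by
  have hqb := qb_ne_zero i r a c hi hN
  have hf : qb i r a c ^ 4 / r ^ 4 ≠ 0 := div_ne_zero (pow_ne_zero 4 hqb) (pow_ne_zero 4 hr)
  unfold I1in
  rw [e3_f_in D i r a c hi hr hN hDr hDa hDc hDi]
  field_simp

/-- `[J]` D.3: "Hence, recalling the definition of `C₁` in (5.2.3), `I₁ = C₁`" (ingoing, `f = q̄⁴/r⁴`).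
[cite: GiorgiKlainermanSzeftel2024, p.820 L15–40; GiorgiKlainermanSzeftel2022, l.33701–33705] -/
theorem I1_in_eq_C1 (i r a c : K) (hi : i ^ 2 = -1) (hr : r ≠ 0) (hN : nsq r a c ≠ 0)
    (hDr : D r = -1) (hDa : D a = 0) (hDc : D c = 0) (hDi : D i = 0) :
    I1in D r (qb i r a c ^ 4 / r ^ 4) = C1 i (trchbI r a c) (atrchbI r a c) := by
  rw [I1_in_line D i r a c hi hr hN hDr hDa hDc hDi]
  unfold C1 trchbI atrchbI
  unfold nsq at *
  field_simp
  ring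

/-- `[J]` D.3: "Hence `I₂ = C₂`" (ingoing, `f = q̄⁴/r⁴`), assembled exactly as printed:
`I₂ = ½(∇₃I₁ + ½I₁²)`, `I₁ = C₁`, and `∇₃C₁ + ½C₁² = 2C₂` under the Kerr values of
`∇₃ tr χ̲`, `∇₃ ⁽ᵃ⁾tr χ̲`. [cite: GiorgiKlainermanSzeftel2024, p.820 L41–p.821 L63; GiorgiKlainermanSzeftel2022, l.33707–33741] -/
theorem I2_in_eq_C2 (i r a c : K) (hi : i ^ 2 = -1) (hr : r ≠ 0) (hN : nsq r a c ≠ 0)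
    (hDr : D r = -1) (hDa : D a = 0) (hDc : D c = 0) (hDi : D i = 0) :
    I2in D r (qb i r a c ^ 4 / r ^ 4) = C2 i (trchbI r a c) (atrchbI r a c) := by
  have hqb := qb_ne_zero i r a c hi hN
  have hf : qb i r a c ^ 4 / r ^ 4 ≠ 0 := div_ne_zero (pow_ne_zero 4 hqb) (pow_ne_zero 4 hr)
  have hx : trchbI r a c ≠ 0 := by
    unfold trchbI; exact div_ne_zero (neg_ne_zero.mpr (mul_ne_zero two_ne_zero hr)) hN
  rw [I2_via_I1_in D r _ hr hf hDr, I1_in_eq_C1 D i r a c hi hr hN hDr hDa hDc hDi]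
  have hB := (C1_to_C2 D i (trchbI r a c) (atrchbI r a c) hi hx hDi
    (e3_trchb_in D r a c hN hDr hDa hDc) (e3_atrchb_in D r a c hN hDr hDa hDc)).2
  linear_combination (1 / 2 : K) * hB

omit [CharZero K] in
/-- `r⁴f = (q̄/q)·q q̄³` for `f = q̄⁴/r⁴`. [cite: GiorgiKlainermanSzeftel2024, p.821 L63–66; GiorgiKlainermanSzeftel2022, l.33741–33743] -/
theorem r4f_in (i r a c : K) (hi : i ^ 2 = -1) (hr : r ≠ 0) (hN : nsq r a c ≠ 0) :
    r ^ 4 * (qb i r a c ^ 4 / r ^ 4) = qb i r a c / qq i r a c * (qq i r a c * qb i r a c ^ 3) := by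
  have hq := qq_ne_zero i r a c hi hN
  field_simp

/-- `[J]` Proposition 5.2.4, (5.2.6), in Kerr, ingoing normalisation:
`r∇₃(r²∇₃(r (q̄⁴/r⁴) A)) = (q̄/q) 𝔮`, `𝔮 = q q̄³(∇₃∇₃A + C₁∇₃A + C₂A)`, for any Leibniz operator `∇₃`
over the scalar derivation `e₃` with the printed Kerr values.
[cite: GiorgiKlainermanSzeftel2024, Proposition 5.2.4 (5.2.6) p.190 L53–129 and D.3 p.821 L63–66; GiorgiKlainermanSzeftel2022, l.8736, l.33743] -/
theorem prop524_first (i r a c : K) (A : M) (hi : i ^ 2 = -1) (hr : r ≠ 0) (hN : nsq r a c ≠ 0)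
    (hDr : D r = -1) (hDa : D a = 0) (hDc : D c = 0) (hDi : D i = 0) :
    r • nab.op (r ^ 2 • nab.op ((r * (qb i r a c ^ 4 / r ^ 4)) • A))
      = (qb i r a c / qq i r a c) •
          qfrak nab (qq i r a c * qb i r a c ^ 3) (C1 i (trchbI r a c) (atrchbI r a c))
            (C2 i (trchbI r a c) (atrchbI r a c)) A := by
  have hqb := qb_ne_zero i r a c hi hN
  have hf : qb i r a c ^ 4 / r ^ 4 ≠ 0 := div_ne_zero (pow_ne_zero 4 hqb) (pow_ne_zero 4 hr)
  rw [expand_I D nab, coeff1_in D r _ hDr, coeff0_in D r _ hDr, coeff1_in_I1 D r _ hr hf,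
    coeff0_in_I2 D r _ hr hf, I1_in_eq_C1 D i r a c hi hr hN hDr hDa hDc hDi,
    I2_in_eq_C2 D i r a c hi hr hN hDr hDa hDc hDi, r4f_in i r a c hi hr hN]
  unfold qfrak
  simp only [smul_add, smul_smul]
  ring_nf

/-- `[J]` Proposition 5.2.4, (5.2.7), in Kerr, ingoing: `r²∇₃∇₃((q̄⁴/r²)A) = (q̄/q) 𝔮`.
[cite: GiorgiKlainermanSzeftel2024, (5.2.7) p.190 L129 and D.3 p.821 L80–90; GiorgiKlainermanSzeftel2022, l.8737, l.33747–33759] -/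
theorem prop524_second (i r a c : K) (A : M) (hi : i ^ 2 = -1) (hr : r ≠ 0) (hN : nsq r a c ≠ 0)
    (hDr : D r = -1) (hDa : D a = 0) (hDc : D c = 0) (hDi : D i = 0) :
    r ^ 2 • nab.op (nab.op ((qb i r a c ^ 4 / r ^ 2) • A))
      = (qb i r a c / qq i r a c) •
          qfrak nab (qq i r a c * qb i r a c ^ 3) (C1 i (trchbI r a c) (atrchbI r a c))
            (C2 i (trchbI r a c) (atrchbI r a c)) A := by
  have hqb := qb_ne_zero i r a c hi hN
  have hf : qb i r a c ^ 4 / r ^ 4 ≠ 0 := div_ne_zero (pow_ne_zero 4 hqb) (pow_ne_zero 4 hr)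
  have hre : qb i r a c ^ 4 / r ^ 2 = r ^ 2 * (qb i r a c ^ 4 / r ^ 4) := by field_simp
  rw [hre, expand_E D nab, coeff1_in_I1' D r _ hr hf hDr, coeff0_in_I2' D r _ hr hf hDr,
    I1_in_eq_C1 D i r a c hi hr hN hDr hDa hDc hDi, I2_in_eq_C2 D i r a c hi hr hN hDr hDa hDc hDi,
    r4f_in i r a c hi hr hN]
  unfold qfrak
  simp only [smul_add, smul_smul]
  ring_nf

/-! ## §5. `[J]` Lemma 5.2.6 and Proposition 5.2.5 (ingoing frame) -/

omit [CharZero K] in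
/-- Footnote to `[J]` Lemma 5.2.6 (p = q q̄⁻¹, ingoing `e₃(r) = −1`):
`e₃(p) = −q̄⁻¹ + q q̄⁻² = 2ai cos θ q̄⁻² = p i ⁽ᵃ⁾tr χ̲`.
[cite: GiorgiKlainermanSzeftel2024, p.191 L76 (footnote 2); GiorgiKlainermanSzeftel2022, l.8785] -/
theorem footnote_e3p (i r a c : K) (hi : i ^ 2 = -1) (hN : nsq r a c ≠ 0) (hDr : D r = -1)
    (hDa : D a = 0) (hDc : D c = 0) (hDi : D i = 0) :
    D (qq i r a c / qb i r a c) = -(qb i r a c)⁻¹ + qq i r a c * (qb i r a c ^ 2)⁻¹ ∧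
    D (qq i r a c / qb i r a c) = 2 * a * i * c * (qb i r a c ^ 2)⁻¹ ∧
    D (qq i r a c / qb i r a c) = qq i r a c / qb i r a c * i * atrchbI r a c := by
  obtain ⟨i3, i4, -⟩ := ipow i hi
  have hq := qq_ne_zero i r a c hi hN
  have hqb := qb_ne_zero i r a c hi hN
  unfold atrchbI
  unfold qq qb nsq at *
  simp only [map_add, map_sub, D.leibniz, D.leibniz_div, hDr, hDa, hDc, hDi, smul_eq_mul, mul_zero,
    add_zero, sub_zero]
  refine ⟨?_, ?_, ?_⟩
  · field_simp; ring
  · field_simp; ring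
  · field_simp
    (try ring_nf); (try simp only [i3]); (try ring_nf)

omit [CharZero K] in
/-- `[J]` Lemma 5.2.6, scalar content: since `e₃p = i ⁽ᵃ⁾tr χ̲ p`,
`e₃(u) + i ⁽ᵃ⁾tr χ̲ u = p⁻¹ e₃(p u)` for every scalar `u` (this is `(∇₃U)₁₁ = p⁻¹e₃(pU₁₁)` once
`∇₃U₁₁ = e₃U₁₁ + i ⁽ᵃ⁾tr χ̲ U₁₁`). [cite: GiorgiKlainermanSzeftel2024, Lemma 5.2.6 p.191 L34–41; GiorgiKlainermanSzeftel2022, l.8772–8791] -/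
theorem lemma526_scalar (i r a c u : K) (hi : i ^ 2 = -1) (hN : nsq r a c ≠ 0) (hDr : D r = -1)
    (hDa : D a = 0) (hDc : D c = 0) (hDi : D i = 0) :
    D u + i * atrchbI r a c * u = qb i r a c / qq i r a c * D (qq i r a c / qb i r a c * u) := by
  have hq := qq_ne_zero i r a c hi hN
  have hqb := qb_ne_zero i r a c hi hN
  have hp := (footnote_e3p D i r a c hi hN hDr hDa hDc hDi).2.2
  rw [D.leibniz, hp, smul_eq_mul, smul_eq_mul]
  field_simp

/-- `[J]` Proposition 5.2.5, proof: iterating Lemma 5.2.6,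
`r N(r² N(r w)) = p⁻¹ r e₃(r² e₃(r p w))` with `N = e₃ + i ⁽ᵃ⁾tr χ̲`, `p = q/q̄` (ingoing).
[cite: GiorgiKlainermanSzeftel2024, p.191 L42–60; GiorgiKlainermanSzeftel2022, l.8793–8800] -/
theorem lemma526_iterated (i r a c w : K) (hi : i ^ 2 = -1) (hN : nsq r a c ≠ 0) (hDr : D r = -1)
    (hDa : D a = 0) (hDc : D c = 0) (hDi : D i = 0) :
    r * (D (r ^ 2 * (D (r * w) + i * atrchbI r a c * (r * w)))
          + i * atrchbI r a c * (r ^ 2 * (D (r * w) + i * atrchbI r a c * (r * w))))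
      = qb i r a c / qq i r a c * (r * D (r ^ 2 * D (r * (qq i r a c / qb i r a c * w)))) := by
  have hq := qq_ne_zero i r a c hi hN
  have hqb := qb_ne_zero i r a c hi hN
  set κ := i * atrchbI r a c with hκ
  have step : ∀ u : K, D u + κ * u = qb i r a c / qq i r a c * D (qq i r a c / qb i r a c * u) :=
    fun u => lemma526_scalar D i r a c u hi hN hDr hDa hDc hDi
  have s1 : D (r * (qq i r a c / qb i r a c * w))
      = qq i r a c / qb i r a c * (D (r * w) + κ * (r * w)) := by
    rw [step (r * w)]; field_simp
  have s2 : D (r ^ 2 * D (r * (qq i r a c / qb i r a c * w)))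
      = qq i r a c / qb i r a c *
          (D (r ^ 2 * (D (r * w) + κ * (r * w))) + κ * (r ^ 2 * (D (r * w) + κ * (r * w)))) := by
    rw [s1, show r ^ 2 * (qq i r a c / qb i r a c * (D (r * w) + κ * (r * w)))
        = qq i r a c / qb i r a c * (r ^ 2 * (D (r * w) + κ * (r * w))) by ring,
      step (r ^ 2 * (D (r * w) + κ * (r * w)))]
    field_simp
  rw [s2]
  field_simp

omit [CharZero K] in
/-- `[J]` Proposition 5.2.5, last step: with `p = q/q̄`, `p · (q̄⁴/r⁴) · p = |q|⁴/r⁴`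
(substituting `A₁₁ = −p α` into `r∇₃(r²∇₃(r p (q̄⁴/r⁴) A₁₁))`).
[cite: GiorgiKlainermanSzeftel2024, (5.2.8) p.191 L19–31 and p.191 L60–75; GiorgiKlainermanSzeftel2022, l.8766, l.8801–8805] -/
theorem prop525_subst (i r a c : K) (hi : i ^ 2 = -1) (hN : nsq r a c ≠ 0) :
    qq i r a c / qb i r a c * (qb i r a c ^ 4 / r ^ 4) * (qq i r a c / qb i r a c)
      = nsq r a c ^ 2 / r ^ 4 := by
  have hqb := qb_ne_zero i r a c hi hN
  rw [nsq_eq_qq_mul_qb i r a c hi]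
  by_cases hr : r = 0
  · subst hr; simp
  · field_simp

/-! ## §6. `[J]` Proposition 5.3.5 (outgoing frame, `e₄(r) = 1`) -/

omit [CharZero K] in
/-- Proof of `[J]` Proposition 5.3.5: `e₄f₁ = −(4a²cos²θ/(r|q|²)) f₁`, `f₁ = |q|⁴/r⁴`.
[cite: GiorgiKlainermanSzeftel2024, p.199 L60–70; GiorgiKlainermanSzeftel2022, l.9139] -/
theorem e4_f1_out (r a c : K) (hr : r ≠ 0) (hDr : D r = 1) (hDa : D a = 0) (hDc : D c = 0) :
    D (nsq r a c ^ 2 / r ^ 4) = -(4 * a ^ 2 * c ^ 2 / (r * nsq r a c)) * (nsq r a c ^ 2 / r ^ 4) := by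
  have hDn : D (nsq r a c) = 2 * r := by
    unfold nsq
    simp only [map_add, D.leibniz, D.leibniz_pow, hDr, hDa, hDc, smul_eq_mul, nsmul_eq_mul,
      Nat.cast_ofNat, mul_zero, add_zero, smul_zero]
    ring
  rw [D.leibniz_div, D.leibniz_pow, D.leibniz_pow, hDn, hDr]
  simp only [smul_eq_mul, nsmul_eq_mul, Nat.cast_ofNat]
  unfold nsq at *
  field_simp
  ring

omit [CharZero K] in
/-- Proof of `[J]` Proposition 5.3.5: `e₄f₂ = −i ⁽ᵃ⁾tr χ f₂`, `f₂ = q/q̄`.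
[cite: GiorgiKlainermanSzeftel2024, p.199 L60–70; GiorgiKlainermanSzeftel2022, l.9140] -/
theorem e4_f2_out (i r a c : K) (hi : i ^ 2 = -1) (hN : nsq r a c ≠ 0) (hDr : D r = 1)
    (hDa : D a = 0) (hDc : D c = 0) (hDi : D i = 0) :
    D (qq i r a c / qb i r a c) = -i * atrchO r a c * (qq i r a c / qb i r a c) := by
  obtain ⟨i3, i4, -⟩ := ipow i hi
  have hq := qq_ne_zero i r a c hi hN
  have hqb := qb_ne_zero i r a c hi hN
  unfold atrchO
  unfold qq qb nsq at *
  simp only [map_add, map_sub, D.leibniz, D.leibniz_div, hDr, hDa, hDc, hDi, smul_eq_mul, mul_zero,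
    add_zero, sub_zero]
  field_simp
  (try ring_nf); (try simp only [i3]); (try ring_nf)

omit [CharZero K] in
/-- Proof of `[J]` Proposition 5.3.5: `e₄f = (−4a²cos²θ/(r|q|²) − 2i ⁽ᵃ⁾tr χ) f`, `f = q⁴/r⁴`.
[cite: GiorgiKlainermanSzeftel2024, p.199 L70–75; GiorgiKlainermanSzeftel2022, l.9142] -/
theorem e4_f_out (i r a c : K) (hi : i ^ 2 = -1) (hr : r ≠ 0) (hN : nsq r a c ≠ 0) (hDr : D r = 1)
    (hDa : D a = 0) (hDc : D c = 0) (hDi : D i = 0) :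
    D (qq i r a c ^ 4 / r ^ 4)
      = (-(4 * a ^ 2 * c ^ 2 / (r * nsq r a c)) - 2 * i * atrchO r a c) * (qq i r a c ^ 4 / r ^ 4) := by
  obtain ⟨i3, i4, i5, i6, -⟩ := ipow i hi
  have hq := qq_ne_zero i r a c hi hN
  have hDq : D (qq i r a c) = 1 := by
    unfold qq; simp only [map_add, D.leibniz, hDr, hDa, hDc, hDi, smul_eq_mul, mul_zero, add_zero]
  rw [D.leibniz_div, D.leibniz_pow, D.leibniz_pow, hDq, hDr]
  simp only [smul_eq_mul, nsmul_eq_mul, Nat.cast_ofNat]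
  unfold atrchO
  unfold qq nsq at *
  field_simp
  (try ring_nf); (try simp only [hi, i3, i4, i5]); (try ring_nf)

/-- Proof of `[J]` Proposition 5.3.5, the display for `I₁`.  PRINT DATUM PD5: its first line
"`2(−4a²cos²θ/(r|q|²) + 2r/|q|² − 2i ⁽ᵃ⁾tr χ)`" should read `… + 2/r …` (first conjunct); the second
line "`2(−2a²cos²θ/(r|q|²) + 2r/|q|² − 2i ⁽ᵃ⁾tr χ)`" is correct (second conjunct).
[cite: GiorgiKlainermanSzeftel2024, p.199 L75–95; GiorgiKlainermanSzeftel2022, l.9146–9148] -/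
theorem I1_out_lines (i r a c : K) (hi : i ^ 2 = -1) (hr : r ≠ 0) (hN : nsq r a c ≠ 0)
    (hDr : D r = 1) (hDa : D a = 0) (hDc : D c = 0) (hDi : D i = 0) :
    I1out D r (qq i r a c ^ 4 / r ^ 4)
        = 2 * (-(4 * a ^ 2 * c ^ 2 / (r * nsq r a c)) + 2 / r - 2 * i * atrchO r a c) ∧
    I1out D r (qq i r a c ^ 4 / r ^ 4)
        = 2 * (-(2 * a ^ 2 * c ^ 2 / (r * nsq r a c)) + 2 * r / nsq r a c - 2 * i * atrchO r a c) := by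
  have hq := qq_ne_zero i r a c hi hN
  have hf : qq i r a c ^ 4 / r ^ 4 ≠ 0 := div_ne_zero (pow_ne_zero 4 hq) (pow_ne_zero 4 hr)
  unfold I1out
  rw [e4_f_out D i r a c hi hr hN hDr hDa hDc hDi]
  constructor
  · field_simp
    ring
  · unfold nsq at *
    field_simp
    ring

/-- Proof of `[J]` Proposition 5.3.5: `I₁ = 2tr χ − 2 ⁽ᵃ⁾tr χ²/tr χ − 4i ⁽ᵃ⁾tr χ = C̲₁` (`f = q⁴/r⁴`).
[cite: GiorgiKlainermanSzeftel2024, p.199 L95–100; GiorgiKlainermanSzeftel2022, l.9149] -/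
theorem I1_out_eq_C1 (i r a c : K) (hi : i ^ 2 = -1) (hr : r ≠ 0) (hN : nsq r a c ≠ 0)
    (hDr : D r = 1) (hDa : D a = 0) (hDc : D c = 0) (hDi : D i = 0) :
    I1out D r (qq i r a c ^ 4 / r ^ 4) = C1 i (trchO r a c) (atrchO r a c) := by
  rw [(I1_out_lines D i r a c hi hr hN hDr hDa hDc hDi).2]
  unfold C1 trchO atrchO
  unfold nsq at *
  field_simp
  ring

/-- Proof of `[J]` Proposition 5.3.5: "Similarly … `I₂ = C̲₂`" (`f = q⁴/r⁴`, outgoing), assembled from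
`I₂ = ½(∇₄I₁ + ½I₁²)`, `I₁ = C̲₁` and the `(x, y)`-lemma under `∇₄ tr χ = −½(tr χ² − ⁽ᵃ⁾tr χ²)`,
`∇₄ ⁽ᵃ⁾tr χ = −tr χ ⁽ᵃ⁾tr χ`. [cite: GiorgiKlainermanSzeftel2024, p.199 L118; GiorgiKlainermanSzeftel2022, l.9151] -/
theorem I2_out_eq_C2 (i r a c : K) (hi : i ^ 2 = -1) (hr : r ≠ 0) (hN : nsq r a c ≠ 0)
    (hDr : D r = 1) (hDa : D a = 0) (hDc : D c = 0) (hDi : D i = 0) :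
    I2out D r (qq i r a c ^ 4 / r ^ 4) = C2 i (trchO r a c) (atrchO r a c) := by
  have hq := qq_ne_zero i r a c hi hN
  have hf : qq i r a c ^ 4 / r ^ 4 ≠ 0 := div_ne_zero (pow_ne_zero 4 hq) (pow_ne_zero 4 hr)
  have hx : trchO r a c ≠ 0 := by
    unfold trchO; exact div_ne_zero (mul_ne_zero two_ne_zero hr) hN
  rw [I2_via_I1_out D r _ hr hf hDr, I1_out_eq_C1 D i r a c hi hr hN hDr hDa hDc hDi]
  have hB := (C1_to_C2 D i (trchO r a c) (atrchO r a c) hi hx hDi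
    (e4_trch_out D r a c hN hDr hDa hDc) (e4_atrch_out D r a c hN hDr hDa hDc)).2
  linear_combination (1 / 2 : K) * hB

omit [CharZero K] in
/-- `r⁴f = (q/q̄)·q̄ q³` for `f = q⁴/r⁴`. [cite: GiorgiKlainermanSzeftel2024, p.199 L41–45; GiorgiKlainermanSzeftel2022, l.9131–9133] -/
theorem r4f_out (i r a c : K) (hi : i ^ 2 = -1) (hr : r ≠ 0) (hN : nsq r a c ≠ 0) :
    r ^ 4 * (qq i r a c ^ 4 / r ^ 4) = qq i r a c / qb i r a c * (qb i r a c * qq i r a c ^ 3) := by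
  have hqb := qb_ne_zero i r a c hi hN
  field_simp

/-- `[J]` Proposition 5.3.5, (5.3.4): `r∇₄(r²∇₄(r (q⁴/r⁴) A̲)) = (q/q̄) 𝔮̲`, `𝔮̲ = q̄ q³(∇₄∇₄A̲ + C̲₁∇₄A̲ + C̲₂A̲)`.
[cite: GiorgiKlainermanSzeftel2024, (5.3.4) p.199 L6–15; GiorgiKlainermanSzeftel2022, l.9116] -/
theorem prop535_first (i r a c : K) (A : M) (hi : i ^ 2 = -1) (hr : r ≠ 0) (hN : nsq r a c ≠ 0)
    (hDr : D r = 1) (hDa : D a = 0) (hDc : D c = 0) (hDi : D i = 0) :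
    r • nab.op (r ^ 2 • nab.op ((r * (qq i r a c ^ 4 / r ^ 4)) • A))
      = (qq i r a c / qb i r a c) •
          qfrak nab (qb i r a c * qq i r a c ^ 3) (C1 i (trchO r a c) (atrchO r a c))
            (C2 i (trchO r a c) (atrchO r a c)) A := by
  have hq := qq_ne_zero i r a c hi hN
  have hf : qq i r a c ^ 4 / r ^ 4 ≠ 0 := div_ne_zero (pow_ne_zero 4 hq) (pow_ne_zero 4 hr)
  rw [expand_I D nab, coeff1_out D r _ hDr, coeff0_out D r _ hDr, coeff1_out_I1 D r _ hr hf,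
    coeff0_out_I2 D r _ hr hf, I1_out_eq_C1 D i r a c hi hr hN hDr hDa hDc hDi,
    I2_out_eq_C2 D i r a c hi hr hN hDr hDa hDc hDi, r4f_out i r a c hi hr hN]
  unfold qfrak
  simp only [smul_add, smul_smul]
  ring_nf

/-- `[J]` Proposition 5.3.5, (5.3.5): `∇₄∇₄((q⁴/r²) A̲) = (q/q̄) r⁻² 𝔮̲`.
[cite: GiorgiKlainermanSzeftel2024, (5.3.5) p.199 L39; GiorgiKlainermanSzeftel2022, l.9121] -/
theorem prop535_second (i r a c : K) (A : M) (hi : i ^ 2 = -1) (hr : r ≠ 0) (hN : nsq r a c ≠ 0)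
    (hDr : D r = 1) (hDa : D a = 0) (hDc : D c = 0) (hDi : D i = 0) :
    nab.op (nab.op ((qq i r a c ^ 4 / r ^ 2) • A))
      = (qq i r a c / qb i r a c / r ^ 2) •
          qfrak nab (qb i r a c * qq i r a c ^ 3) (C1 i (trchO r a c) (atrchO r a c))
            (C2 i (trchO r a c) (atrchO r a c)) A := by
  have hq := qq_ne_zero i r a c hi hN
  have hf : qq i r a c ^ 4 / r ^ 4 ≠ 0 := div_ne_zero (pow_ne_zero 4 hq) (pow_ne_zero 4 hr)
  have hre : qq i r a c ^ 4 / r ^ 2 = r ^ 2 * (qq i r a c ^ 4 / r ^ 4) := by field_simp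
  have key : r ^ 2 • nab.op (nab.op ((qq i r a c ^ 4 / r ^ 2) • A))
      = (qq i r a c / qb i r a c) •
          qfrak nab (qb i r a c * qq i r a c ^ 3) (C1 i (trchO r a c) (atrchO r a c))
            (C2 i (trchO r a c) (atrchO r a c)) A := by
    rw [hre, expand_E D nab, coeff1_out_I1' D r _ hr hf hDr, coeff0_out_I2' D r _ hr hf hDr,
      I1_out_eq_C1 D i r a c hi hr hN hDr hDa hDc hDi, I2_out_eq_C2 D i r a c hi hr hN hDr hDa hDc hDi,
      r4f_out i r a c hi hr hN]
    unfold qfrak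
    simp only [smul_add, smul_smul]
    ring_nf
  have hr2 : r ^ 2 ≠ 0 := pow_ne_zero 2 hr
  calc nab.op (nab.op ((qq i r a c ^ 4 / r ^ 2) • A))
      = (r ^ 2)⁻¹ • (r ^ 2 • nab.op (nab.op ((qq i r a c ^ 4 / r ^ 2) • A))) := by
        rw [smul_smul, inv_mul_cancel₀ hr2, one_smul]
    _ = (qq i r a c / qb i r a c / r ^ 2) •
          qfrak nab (qb i r a c * qq i r a c ^ 3) (C1 i (trchO r a c) (atrchO r a c))
            (C2 i (trchO r a c) (atrchO r a c)) A := by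
        rw [key, smul_smul]; congr 1; field_simp

end CovDer

/-! ## §7. The potential (`[J]` Remark 5.2.11, Proposition D.4.5, Theorem 5.2.9/D.4.7) -/

/-- `[J]` Remark 5.2.11: for `a = 0` the potential is the Schwarzschild Regge–Wheeler potential
`V₀ = (4/r²)(1 − 2m/r)`. [cite: GiorgiKlainermanSzeftel2024, Remark 5.2.11 p.194 L20–27; GiorgiKlainermanSzeftel2022, l.8867] -/
theorem Vpot_a_zero (r m c : K) (hr : r ≠ 0) : Vpot r 0 m c = 4 / r ^ 2 * (1 - 2 * m / r) := by
  unfold Vpot nsq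
  field_simp
  ring

omit [CharZero K] in
/-- In Kerr, outgoing frame, `−tr χ tr χ̲ = 4r²Δ/|q|⁶` (the quantity named in
"`V = −tr χ tr χ̲ + O(|a|/r⁴)`", `[J]` Theorem 5.2.9). [folklore] -/
theorem neg_trch_trchb_out (r a m c : K) (hN : nsq r a c ≠ 0) :
    -(trchO r a c * trchbO r a m c) = 4 * r ^ 2 * Del r a m / nsq r a c ^ 3 := by
  unfold trchO trchbO
  field_simp
  ring

omit [CharZero K] in
/-- In Kerr, ingoing frame, `−tr χ tr χ̲ = 4r²Δ/|q|⁶` as well. [folklore] -/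
theorem neg_trch_trchb_in (r a m c : K) (hN : nsq r a c ≠ 0) :
    -(trchI r a m c * trchbI r a c) = 4 * r ^ 2 * Del r a m / nsq r a c ^ 3 := by
  unfold trchI trchbI
  field_simp
  ring

/-- Quantified form of "`V = −tr χ tr χ̲ + O(|a|/r⁴)`":
`V − 4r²Δ/|q|⁶ = 4a²(r⁴(1 + cos²θ) − 10m cos²θ r³ + 4a²cos²θ r² − 2ma²cos⁴θ r + 2a⁴cos⁴θ)/(r²|q|⁶)`.
[cite: GiorgiKlainermanSzeftel2024, Theorem 5.2.9 p.193 L37–41; GiorgiKlainermanSzeftel2022, l.8867] -/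
theorem Vpot_sub (r a m c : K) (hr : r ≠ 0) (hN : nsq r a c ≠ 0) :
    Vpot r a m c - 4 * r ^ 2 * Del r a m / nsq r a c ^ 3
      = 4 * a ^ 2 * (r ^ 4 * (1 + c ^ 2) - 10 * m * c ^ 2 * r ^ 3 + 4 * a ^ 2 * c ^ 2 * r ^ 2
          - 2 * m * a ^ 2 * c ^ 4 * r + 2 * a ^ 4 * c ^ 4) / (r ^ 2 * nsq r a c ^ 3) := by
  unfold Vpot Del
  unfold nsq at *
  field_simp
  ring

/-- DIVERGENCE DV1, quantified: the `[v1]`-only expression `V₀ = 4Δ/((r² + a²)|q|²)` differs from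
`−tr χ tr χ̲ = 4r²Δ/|q|⁶` by `4a²Δ(r²(2cos²θ − 1) + a²cos⁴θ)/((r² + a²)|q|⁶)`.
[cite: GiorgiKlainermanSzeftel2022, l.8907] -/
theorem V0v1_sub (r a m c : K) (hN : nsq r a c ≠ 0) (hra : r ^ 2 + a ^ 2 ≠ 0) :
    V0v1 r a m c - 4 * r ^ 2 * Del r a m / nsq r a c ^ 3
      = 4 * a ^ 2 * Del r a m * (r ^ 2 * (2 * c ^ 2 - 1) + a ^ 2 * c ^ 4)
          / ((r ^ 2 + a ^ 2) * nsq r a c ^ 3) := by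
  unfold V0v1
  unfold nsq at *
  field_simp
  ring

/-- At `a = 0` the `[v1]` expression also reduces to `(4/r²)(1 − 2m/r)`. [cite: GiorgiKlainermanSzeftel2022, l.8907] -/
theorem V0v1_a_zero (r m c : K) (hr : r ≠ 0) : V0v1 r 0 m c = 4 / r ^ 2 * (1 - 2 * m / r) := by
  unfold V0v1 Del nsq
  field_simp
  ring

/-- `[J]` p.856: `div η̲ = e₁(η̲₁) + Λη̲₁ = ((−3cos²θ + 1)a²r² + a⁴cos²θ(−3 + cos²θ))/|q|⁶`
(`e₁ = |q|⁻¹∂_θ`). [cite: GiorgiKlainermanSzeftel2024, p.856 L48–60; GiorgiKlainermanSzeftel2022, l.34995] -/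
theorem div_etab (E : Derivation ℤ K K) (r a c s n : K) (hn : n ^ 2 = nsq r a c) (hn0 : n ≠ 0)
    (hs0 : s ≠ 0) (hsc : s ^ 2 + c ^ 2 = 1) (hEr : E r = 0) (hEa : E a = 0) (hEc : E c = -s)
    (hEs : E s = c) :
    1 / n * E (etab1 a c s n) + Lam r a c s n * etab1 a c s n = divEtab r a c := by
  have hEn := E_absq E r a c s n hn hn0 hEr hEa hEc
  have hs2 : s ^ 2 = 1 - c ^ 2 := by linear_combination hsc
  obtain ⟨n3, n4, n5, n6, n7, n8, n9, n10, n11, n12, n13, n14, -⟩ := sqpow n _ hn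
  obtain ⟨s3, s4, s5, s6, -⟩ := sqpow s _ hs2
  have hN := nsq_ne_zero_of_sq r a c n hn hn0
  unfold etab1 Lam divEtab
  simp only [map_neg, E.leibniz_div, E.leibniz, E.leibniz_pow, hEa, hEc, hEs, hEn,
    smul_eq_mul, nsmul_eq_mul, Nat.cast_ofNat, mul_zero, add_zero, smul_zero]
  unfold nsq at *
  field_simp
  (try ring_nf); (try simp only [hn, n4, n8, hs2]);
    (try ring_nf)

/-- `[J]` p.856: `curl η̲ = e₁(η̲₂) + Λη̲₂ = (a cos θ/|q|⁶)(−2r³ + 2a²cos²θ r − 4a²r)`.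
[cite: GiorgiKlainermanSzeftel2024, p.856 L48–60; GiorgiKlainermanSzeftel2022, l.34996] -/
theorem curl_etab (E : Derivation ℤ K K) (r a c s n : K) (hn : n ^ 2 = nsq r a c) (hn0 : n ≠ 0)
    (hs0 : s ≠ 0) (hsc : s ^ 2 + c ^ 2 = 1) (hEr : E r = 0) (hEa : E a = 0) (hEc : E c = -s)
    (hEs : E s = c) :
    1 / n * E (etab2 r a s n) + Lam r a c s n * etab2 r a s n = curlEtab r a c := by
  have hEn := E_absq E r a c s n hn hn0 hEr hEa hEc
  have hs2 : s ^ 2 = 1 - c ^ 2 := by linear_combination hsc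
  obtain ⟨n3, n4, n5, n6, n7, n8, n9, n10, n11, n12, n13, n14, -⟩ := sqpow n _ hn
  obtain ⟨s3, s4, s5, s6, -⟩ := sqpow s _ hs2
  have hN := nsq_ne_zero_of_sq r a c n hn hn0
  unfold etab2 Lam curlEtab
  simp only [map_neg, E.leibniz_div, E.leibniz, E.leibniz_pow, hEr, hEa, hEs, hEn,
    smul_eq_mul, nsmul_eq_mul, Nat.cast_ofNat, mul_zero, add_zero]
  unfold nsq at *
  field_simp
  (try ring_nf); (try simp only [hn, n4, n8, hs2]);
    (try ring_nf)

omit [CharZero K] in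
/-- `|η̲|² = a² sin²θ/|q|⁴` on the printed components. [folklore] -/
theorem etab_sq (r a c s n : K) (hn : n ^ 2 = nsq r a c) (hn0 : n ≠ 0) :
    etab1 a c s n ^ 2 + etab2 r a s n ^ 2 = a ^ 2 * s ^ 2 / nsq r a c ^ 2 := by
  obtain ⟨n3, n4, n5, n6, -⟩ := sqpow n _ hn
  have hN := nsq_ne_zero_of_sq r a c n hn hn0
  unfold etab1 etab2
  unfold nsq at *
  field_simp
  (try ring_nf); (try simp only [n6]); (try ring_nf)

omit [CharZero K] in
/-- `η·η̲ = (a⁴sin²θcos²θ − a²r²sin²θ)/|q|⁶` on the printed components. [folklore] -/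
theorem eta_dot_etab (r a c s n : K) (hn : n ^ 2 = nsq r a c) (hn0 : n ≠ 0) :
    eta1 a c s n * etab1 a c s n + eta2 r a s n * etab2 r a s n
      = (a ^ 4 * s ^ 2 * c ^ 2 - a ^ 2 * r ^ 2 * s ^ 2) / nsq r a c ^ 3 := by
  obtain ⟨n3, n4, n5, n6, -⟩ := sqpow n _ hn
  have hN := nsq_ne_zero_of_sq r a c n hn hn0
  unfold eta1 etab1 eta2 etab2
  unfold nsq at *
  field_simp
  (try ring_nf); (try simp only [n6]); (try ring_nf)

/-- `⁽ᵃ⁾tr χ̲/tr χ̲ = −a cos θ/r` (outgoing), used at `[J]` p.855 L81ff. [cite: GiorgiKlainermanSzeftel2024, p.855 L81–p.856 L10; GiorgiKlainermanSzeftel2022, l.34988–34991] -/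
theorem atrchb_div_trchb_out (r a m c : K) (hr : r ≠ 0) (hN : nsq r a c ≠ 0) (hD : Del r a m ≠ 0) :
    atrchbO r a m c / trchbO r a m c = -(a * c / r) := by
  unfold atrchbO trchbO
  field_simp

omit [CharZero K] in
/-- `[J]` p.855, `∇₄ℜ(C₁) = 2∇₄tr χ̲ − 2∇₄(⁽ᵃ⁾tr χ̲²/tr χ̲) = 2∇₄tr χ̲ − 4(⁽ᵃ⁾tr χ̲/tr χ̲)∇₄⁽ᵃ⁾tr χ̲ +
2(⁽ᵃ⁾tr χ̲²/tr χ̲²)∇₄tr χ̲` (Leibniz, any derivation). [cite: GiorgiKlainermanSzeftel2024, p.855 L31–38; GiorgiKlainermanSzeftel2022, l.34974–34975] -/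
theorem e4_ReC1_leibniz (D : Derivation ℤ K K) (X Y : K) (hX : X ≠ 0) :
    D (2 * X - 2 * (Y ^ 2 / X)) = 2 * D X - 4 * (Y / X) * D Y + 2 * (Y ^ 2 / X ^ 2) * D X := by
  obtain ⟨D2, -⟩ := D_num D
  simp only [map_sub, D.leibniz, D.leibniz_pow, D.leibniz_div, D2, smul_eq_mul, nsmul_eq_mul,
    Nat.cast_ofNat, mul_zero, add_zero]
  field_simp
  ring

/-- `[J]` p.855, third line of the same display: substituting the outgoing Kerr values of
`∇₄tr χ̲`, `∇₄⁽ᵃ⁾tr χ̲` (`e4_trchb_out`, `e4_atrchb_out`),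
`∇₄ℜ(C₁) = −tr χ tr χ̲ + ⁽ᵃ⁾tr χ ⁽ᵃ⁾tr χ̲ + 4div η̲ + 4|η̲|² + 4ρ − 4(⁽ᵃ⁾tr χ̲/tr χ̲)(2curl η̲ + 2*ρ)
 + 2(⁽ᵃ⁾tr χ̲²/tr χ̲²)(−½tr χ tr χ̲ + ½⁽ᵃ⁾tr χ ⁽ᵃ⁾tr χ̲ + 2div η̲ + 2|η̲|² + 2ρ)`.
[cite: GiorgiKlainermanSzeftel2024, p.855 L31–45; GiorgiKlainermanSzeftel2022, l.34976–34978] -/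
theorem e4_ReC1_kerr (D : Derivation ℤ K K) (r a m c s n : K) (hn : n ^ 2 = nsq r a c) (hn0 : n ≠ 0)
    (hr : r ≠ 0) (hD : Del r a m ≠ 0) (hsc : s ^ 2 + c ^ 2 = 1) (hDr : D r = 1) (hDa : D a = 0)
    (hDm : D m = 0) (hDc : D c = 0) :
    D (2 * trchbO r a m c - 2 * (atrchbO r a m c ^ 2 / trchbO r a m c))
      = -(trchO r a c * trchbO r a m c) + atrchO r a c * atrchbO r a m c + 4 * divEtab r a c
          + 4 * (etab1 a c s n ^ 2 + etab2 r a s n ^ 2) + 4 * rho r a m c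
        - 4 * (atrchbO r a m c / trchbO r a m c) * (2 * curlEtab r a c + 2 * srho r a m c)
        + 2 * (atrchbO r a m c ^ 2 / trchbO r a m c ^ 2)
            * (-(1 / 2) * trchO r a c * trchbO r a m c + 1 / 2 * atrchO r a c * atrchbO r a m c
                + 2 * divEtab r a c + 2 * (etab1 a c s n ^ 2 + etab2 r a s n ^ 2) + 2 * rho r a m c) := by
  have hN := nsq_ne_zero_of_sq r a c n hn hn0
  have hx : trchbO r a m c ≠ 0 := by
    unfold trchbO
    exact div_ne_zero (neg_ne_zero.mpr (mul_ne_zero (mul_ne_zero two_ne_zero hr) hD)) (pow_ne_zero 2 hN)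
  rw [e4_ReC1_leibniz D _ _ hx, e4_trchb_out D r a m c s n hn hn0 hsc hDr hDa hDm hDc,
    e4_atrchb_out D r a m c hN hDr hDa hDm hDc]
  linear_combination (2 * (atrchbO r a m c / trchbO r a m c)) * id342a_out r a m c

/-- `[J]` p.855: from `V₁ = −2tr χ tr χ̲ + ⁽ᵃ⁾tr χ ⁽ᵃ⁾tr χ̲ + 4ρ + 8div η̲ + 6|η̲|² + 2η·η̲ − ∇₄ℜ(C₁)` and the
third line above, "We therefore obtain
`V₁ = −tr χ tr χ̲ + 4div η̲ + 2|η̲|² + 2η·η̲ + (⁽ᵃ⁾tr χ̲/tr χ̲)[⁽ᵃ⁾tr χ̲ tr χ − (⁽ᵃ⁾tr χ̲²/tr χ̲)⁽ᵃ⁾tr χ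
 − (⁽ᵃ⁾tr χ̲/tr χ̲)(4div η̲ + 4|η̲|² + 4ρ) + 8curl η̲ + 8*ρ]`" — a generic identity
(`x, y, x̲, y̲, ρ, *ρ, div η̲, curl η̲, |η̲|², η·η̲` arbitrary, `x̲ ≠ 0`).
[cite: GiorgiKlainermanSzeftel2024, p.855 L25–p.856 L5; GiorgiKlainermanSzeftel2022, l.34971–34984] -/
theorem V1_regroup (x y xb yb rh srh dv cu e2 ee : K) (hxb : xb ≠ 0) :
    -2 * x * xb + y * yb + 4 * rh + 8 * dv + 6 * e2 + 2 * ee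
        - (-(x * xb) + y * yb + 4 * dv + 4 * e2 + 4 * rh - 4 * (yb / xb) * (2 * cu + 2 * srh)
            + 2 * (yb ^ 2 / xb ^ 2) * (-(1 / 2) * x * xb + 1 / 2 * y * yb + 2 * dv + 2 * e2 + 2 * rh))
      = -(x * xb) + 4 * dv + 2 * e2 + 2 * ee
        + yb / xb * (yb * x - yb ^ 2 / xb * y - yb / xb * (4 * dv + 4 * e2 + 4 * rh) + 8 * cu + 8 * srh) := by
  field_simp
  ring

/-- `[J]` p.856, "Using the values in Kerr given in Section 3.3, we have" — first displayed equality: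
the regrouped expression with the outgoing Kerr values equals
`4r²Δ/|q|⁶ + 4a⁴sin²θcos²θ/|q|⁶ + 4div η̲ − (a cos θ/r)(4aΔcos θ/(r|q|⁴) + (a cos θ/r)(4div η̲ + 4|η̲|² + 4ρ)
 + 8curl η̲ + 8*ρ)`. [cite: GiorgiKlainermanSzeftel2024, p.856 L5–14; GiorgiKlainermanSzeftel2022, l.34986–34989] -/
theorem V1_kerr_values1 (r a m c s n : K) (hn : n ^ 2 = nsq r a c) (hn0 : n ≠ 0) (hr : r ≠ 0)
    (hD : Del r a m ≠ 0) :
    -(trchO r a c * trchbO r a m c) + 4 * divEtab r a c + 2 * (etab1 a c s n ^ 2 + etab2 r a s n ^ 2)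
        + 2 * (eta1 a c s n * etab1 a c s n + eta2 r a s n * etab2 r a s n)
        + atrchbO r a m c / trchbO r a m c
          * (atrchbO r a m c * trchO r a c - atrchbO r a m c ^ 2 / trchbO r a m c * atrchO r a c
              - atrchbO r a m c / trchbO r a m c
                  * (4 * divEtab r a c + 4 * (etab1 a c s n ^ 2 + etab2 r a s n ^ 2) + 4 * rho r a m c)
              + 8 * curlEtab r a c + 8 * srho r a m c)
      = 4 * r ^ 2 * Del r a m / nsq r a c ^ 3 + 4 * a ^ 4 * s ^ 2 * c ^ 2 / nsq r a c ^ 3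
        + 4 * divEtab r a c
        - a * c / r * (4 * a * Del r a m * c / (r * nsq r a c ^ 2)
            + a * c / r * (4 * divEtab r a c + 4 * (etab1 a c s n ^ 2 + etab2 r a s n ^ 2) + 4 * rho r a m c)
            + 8 * curlEtab r a c + 8 * srho r a m c) := by
  obtain ⟨n3, n4, n5, n6, n7, n8, n9, n10, n11, n12, n13, n14, n15, n16, n17, n18⟩ := sqpow n _ hn
  have hN := nsq_ne_zero_of_sq r a c n hn hn0
  rw [etab_sq r a c s n hn hn0, eta_dot_etab r a c s n hn hn0]
  unfold trchO trchbO atrchO atrchbO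
  unfold nsq at *
  field_simp
  ring

omit [CharZero K] in
/-- `[J]` p.856, second displayed equality of the same chain:
`… = 4r²Δ/|q|⁶ + ((r² − a²cos²θ)/r²)4div η̲ − (a cos θ/r)8curl η̲ − (4a²cos²θ/r²)(Δ/|q|⁴ + a⁴sin²θcos²θ/|q|⁶)
 − (4a cos θ/r)((a cos θ/r)ρ + 2*ρ)`. [cite: GiorgiKlainermanSzeftel2024, p.856 L10–14; GiorgiKlainermanSzeftel2022, l.34990–34991] -/
theorem V1_kerr_values2 (r a m c s n : K) (hn : n ^ 2 = nsq r a c) (hn0 : n ≠ 0) (hr : r ≠ 0) :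
    4 * r ^ 2 * Del r a m / nsq r a c ^ 3 + 4 * a ^ 4 * s ^ 2 * c ^ 2 / nsq r a c ^ 3 + 4 * divEtab r a c
        - a * c / r * (4 * a * Del r a m * c / (r * nsq r a c ^ 2)
            + a * c / r * (4 * divEtab r a c + 4 * (etab1 a c s n ^ 2 + etab2 r a s n ^ 2) + 4 * rho r a m c)
            + 8 * curlEtab r a c + 8 * srho r a m c)
      = 4 * r ^ 2 * Del r a m / nsq r a c ^ 3 + (r ^ 2 - a ^ 2 * c ^ 2) / r ^ 2 * (4 * divEtab r a c)
        - a * c / r * (8 * curlEtab r a c)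
        - 4 * a ^ 2 * c ^ 2 / r ^ 2 * (Del r a m / nsq r a c ^ 2 + a ^ 4 * s ^ 2 * c ^ 2 / nsq r a c ^ 3)
        - 4 * a * c / r * (a * c / r * rho r a m c + 2 * srho r a m c) := by
  have hN := nsq_ne_zero_of_sq r a c n hn hn0
  rw [etab_sq r a c s n hn hn0]
  unfold nsq at *
  field_simp
  ring

/-- `[J]` p.856, "we obtain `¼V₁ = …`" — first displayed equality after substituting `div η̲`, `curl η̲`:
`¼[previous] = r²(r² − 2mr + a²)/|q|⁶ + ((−3cos²θ + 1)a²r² + a⁴cos²θ(−3 + cos²θ))/|q|⁶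
 − (a²cos²θ/(r²|q|⁶))(−4r⁴ + (cos²θ − 7)a²r² − 2a⁴cos²θ) − (a²cos²θ/(r²|q|⁴))Δ − (a²cos²θ/(r|q|⁶))(10mr² + 2ma²cos²θ)`.
[cite: GiorgiKlainermanSzeftel2024, p.856 L15–25; GiorgiKlainermanSzeftel2022, l.35000–35002] -/
theorem V1_quarter1 (r a m c s : K) (hr : r ≠ 0) (hN : nsq r a c ≠ 0) (hsc : s ^ 2 + c ^ 2 = 1) :
    1 / 4 * (4 * r ^ 2 * Del r a m / nsq r a c ^ 3 + (r ^ 2 - a ^ 2 * c ^ 2) / r ^ 2 * (4 * divEtab r a c)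
        - a * c / r * (8 * curlEtab r a c)
        - 4 * a ^ 2 * c ^ 2 / r ^ 2 * (Del r a m / nsq r a c ^ 2 + a ^ 4 * s ^ 2 * c ^ 2 / nsq r a c ^ 3)
        - 4 * a * c / r * (a * c / r * rho r a m c + 2 * srho r a m c))
      = r ^ 2 * (r ^ 2 - 2 * m * r + a ^ 2) / nsq r a c ^ 3
        + 1 / nsq r a c ^ 3 * ((-3 * c ^ 2 + 1) * a ^ 2 * r ^ 2 + a ^ 4 * c ^ 2 * (-3 + c ^ 2))
        - a ^ 2 * c ^ 2 / (r ^ 2 * nsq r a c ^ 3) * (-4 * r ^ 4 + (c ^ 2 - 7) * a ^ 2 * r ^ 2 - 2 * a ^ 4 * c ^ 2)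
        - a ^ 2 * c ^ 2 / (r ^ 2 * nsq r a c ^ 2) * Del r a m
        - a ^ 2 * c ^ 2 / (r * nsq r a c ^ 3) * (10 * m * r ^ 2 + 2 * m * a ^ 2 * c ^ 2) := by
  have hs2 : s ^ 2 = 1 - c ^ 2 := by linear_combination hsc
  rw [hs2]
  unfold divEtab curlEtab rho srho Del
  unfold nsq at *
  field_simp
  ring

omit [CharZero K] in
/-- `[J]` p.856, second displayed equality:
`… = r²(r² − 2mr + 2a²)/|q|⁶ − (a²cos²θ/(r²|q|⁶))(8mr³ − 3a²r² + a²cos²θ r² − a⁴cos²θ)`.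
[cite: GiorgiKlainermanSzeftel2024, p.856 L25–30; GiorgiKlainermanSzeftel2022, l.35003] -/
theorem V1_quarter2 (r a m c : K) (hr : r ≠ 0) (hN : nsq r a c ≠ 0) :
    r ^ 2 * (r ^ 2 - 2 * m * r + a ^ 2) / nsq r a c ^ 3
        + 1 / nsq r a c ^ 3 * ((-3 * c ^ 2 + 1) * a ^ 2 * r ^ 2 + a ^ 4 * c ^ 2 * (-3 + c ^ 2))
        - a ^ 2 * c ^ 2 / (r ^ 2 * nsq r a c ^ 3) * (-4 * r ^ 4 + (c ^ 2 - 7) * a ^ 2 * r ^ 2 - 2 * a ^ 4 * c ^ 2)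
        - a ^ 2 * c ^ 2 / (r ^ 2 * nsq r a c ^ 2) * Del r a m
        - a ^ 2 * c ^ 2 / (r * nsq r a c ^ 3) * (10 * m * r ^ 2 + 2 * m * a ^ 2 * c ^ 2)
      = r ^ 2 * (r ^ 2 - 2 * m * r + 2 * a ^ 2) / nsq r a c ^ 3
        - a ^ 2 * c ^ 2 / (r ^ 2 * nsq r a c ^ 3)
            * (8 * m * r ^ 3 - 3 * a ^ 2 * r ^ 2 + a ^ 2 * c ^ 2 * r ^ 2 - a ^ 4 * c ^ 2) := by
  unfold Del
  unfold nsq at *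
  field_simp
  ring

omit [CharZero K] in
/-- `[J]` p.856 "Writing
`(1/|q|²)(r² − 2mr + 2a²)/r² = ((r⁴ + 2a²r²cos²θ + a⁴cos⁴θ)/|q|⁶)((r² − 2mr + 2a²)/r²)
 = r²(r² − 2mr + 2a²)/|q|⁶ + (a²cos²θ/(r²|q|⁶))(2r⁴ − 4mr³ + 4a²r² + a²cos²θ r² − 2mra²cos²θ + 2a⁴cos²θ)`".
[cite: GiorgiKlainermanSzeftel2024, p.856 L31–45; GiorgiKlainermanSzeftel2022, l.35007–35010] -/
theorem V1_writing (r a m c : K) (hr : r ≠ 0) (hN : nsq r a c ≠ 0) :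
    1 / nsq r a c * ((r ^ 2 - 2 * m * r + 2 * a ^ 2) / r ^ 2)
        = (r ^ 4 + 2 * a ^ 2 * r ^ 2 * c ^ 2 + a ^ 4 * c ^ 4) / nsq r a c ^ 3
            * ((r ^ 2 - 2 * m * r + 2 * a ^ 2) / r ^ 2) ∧
    (r ^ 4 + 2 * a ^ 2 * r ^ 2 * c ^ 2 + a ^ 4 * c ^ 4) / nsq r a c ^ 3
            * ((r ^ 2 - 2 * m * r + 2 * a ^ 2) / r ^ 2)
        = r ^ 2 * (r ^ 2 - 2 * m * r + 2 * a ^ 2) / nsq r a c ^ 3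
          + a ^ 2 * c ^ 2 / (r ^ 2 * nsq r a c ^ 3)
              * (2 * r ^ 4 - 4 * m * r ^ 3 + 4 * a ^ 2 * r ^ 2 + a ^ 2 * c ^ 2 * r ^ 2
                  - 2 * m * r * a ^ 2 * c ^ 2 + 2 * a ^ 4 * c ^ 2) := by
  unfold nsq at *
  constructor
  · field_simp; ring
  · field_simp; ring

/-- `[J]` p.856 "we obtain `¼V₁ = (1/|q|²)(r² − 2mr + 2a²)/r² − (a²cos²θ/(r²|q|⁶))(2r⁴ + 4mr³ + a²r²
 + 2a²cos²θr² − 2mra²cos²θ + a⁴cos²θ)`, as stated" — the last display equals `¼ V1pot` and the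
previous one. [cite: GiorgiKlainermanSzeftel2024, p.856 L45–65; GiorgiKlainermanSzeftel2022, l.35013–35016] -/
theorem V1_quarter_final (r a m c : K) (hr : r ≠ 0) (hN : nsq r a c ≠ 0) :
    r ^ 2 * (r ^ 2 - 2 * m * r + 2 * a ^ 2) / nsq r a c ^ 3
        - a ^ 2 * c ^ 2 / (r ^ 2 * nsq r a c ^ 3)
            * (8 * m * r ^ 3 - 3 * a ^ 2 * r ^ 2 + a ^ 2 * c ^ 2 * r ^ 2 - a ^ 4 * c ^ 2)
      = 1 / 4 * V1pot r a m c := by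
  unfold V1pot
  unfold nsq at *
  field_simp
  ring

/-- The whole chain of `[J]` pp.855–856 in one statement (outgoing frame, `e₄ = ∂ᵣ`):
`V₁ := −2tr χ tr χ̲ + ⁽ᵃ⁾tr χ ⁽ᵃ⁾tr χ̲ + 4ρ + 8div η̲ + 6|η̲|² + 2η·η̲ − e₄(ℜC₁)`, with
`ℜC₁ = 2tr χ̲ − 2⁽ᵃ⁾tr χ̲²/tr χ̲`, equals the closed form `V1pot` of Proposition D.4.5.
[cite: GiorgiKlainermanSzeftel2024, p.855 L25–p.856 L65, Proposition D.4.5 p.851; GiorgiKlainermanSzeftel2022, l.34970–35016, l.34840–34841] -/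
theorem V1_chain (D : Derivation ℤ K K) (r a m c s n : K) (hn : n ^ 2 = nsq r a c) (hn0 : n ≠ 0)
    (hr : r ≠ 0) (hD : Del r a m ≠ 0) (hsc : s ^ 2 + c ^ 2 = 1) (hDr : D r = 1) (hDa : D a = 0)
    (hDm : D m = 0) (hDc : D c = 0) :
    -2 * trchO r a c * trchbO r a m c + atrchO r a c * atrchbO r a m c + 4 * rho r a m c
        + 8 * divEtab r a c + 6 * (etab1 a c s n ^ 2 + etab2 r a s n ^ 2)
        + 2 * (eta1 a c s n * etab1 a c s n + eta2 r a s n * etab2 r a s n)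
        - D (2 * trchbO r a m c - 2 * (atrchbO r a m c ^ 2 / trchbO r a m c))
      = V1pot r a m c := by
  have hN := nsq_ne_zero_of_sq r a c n hn hn0
  have hs2 : s ^ 2 = 1 - c ^ 2 := by linear_combination hsc
  have q1 := atrchb_div_trchb_out r a m c hr hN hD
  have q2 : atrchbO r a m c ^ 2 / trchbO r a m c ^ 2 = (a * c / r) ^ 2 := by
    rw [← div_pow, q1]; ring
  rw [e4_ReC1_kerr D r a m c s n hn hn0 hr hD hsc hDr hDa hDm hDc, etab_sq r a c s n hn hn0,
    eta_dot_etab r a c s n hn hn0, hs2, q2, q1]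
  unfold trchO trchbO atrchO atrchbO rho srho divEtab curlEtab V1pot Del
  unfold nsq at *
  field_simp
  ring

omit [CharZero K] in
/-- `[J]` p.857, `Z₄₃ = −2∇₃(⁽ᵃ⁾tr χ̲²/tr χ̲) + tr χ̲(−2⁽ᵃ⁾tr χ̲²/tr χ̲)
 = −4(⁽ᵃ⁾tr χ̲/tr χ̲)∇₃⁽ᵃ⁾tr χ̲ + 2(⁽ᵃ⁾tr χ̲²/tr χ̲²)∇₃tr χ̲ − 2⁽ᵃ⁾tr χ̲²` (Leibniz, any derivation).
[cite: GiorgiKlainermanSzeftel2024, p.857 L21–30; GiorgiKlainermanSzeftel2022, l.35030–35031] -/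
theorem Z43_leibniz (D : Derivation ℤ K K) (X Y : K) (hX : X ≠ 0) :
    -2 * D (Y ^ 2 / X) + X * (-2 * (Y ^ 2 / X)) = -4 * (Y / X) * D Y + 2 * (Y ^ 2 / X ^ 2) * D X - 2 * Y ^ 2 := by
  simp only [D.leibniz_pow, D.leibniz_div, smul_eq_mul, nsmul_eq_mul, Nat.cast_ofNat]
  field_simp
  ring

omit [CharZero K] in
/-- `[J]` p.857, next two lines: with `∇₃⁽ᵃ⁾tr χ̲ = −tr χ̲ ⁽ᵃ⁾tr χ̲`, `∇₃tr χ̲ = −½(tr χ̲² − ⁽ᵃ⁾tr χ̲²)` (up to `Γ_b`),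
`−4(y/x)(−xy) − (y²/x²)(x² − y²) − 2y² = y² + y⁴/x²`.
[cite: GiorgiKlainermanSzeftel2024, p.857 L30–40; GiorgiKlainermanSzeftel2022, l.35032–35033] -/
theorem Z43_algebra (X Y : K) (hX : X ≠ 0) :
    -4 * (Y / X) * (-(X * Y)) - Y ^ 2 / X ^ 2 * (X ^ 2 - Y ^ 2) - 2 * Y ^ 2 = Y ^ 2 + Y ^ 4 / X ^ 2 := by
  field_simp
  ring

/-- `[J]` Proposition D.4.5: `Z₄₃ = ⁽ᵃ⁾tr χ̲²(1 + ⁽ᵃ⁾tr χ̲²/tr χ̲²) = ⁽ᵃ⁾tr χ̲²|q|²/r² = 4a²Δ²cos²θ/(r²|q|⁶)` (outgoing).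
[cite: GiorgiKlainermanSzeftel2024, Proposition D.4.5 p.851, Theorem D.4.7 p.861 L49; GiorgiKlainermanSzeftel2022, l.34842] -/
theorem Z43_kerr (r a m c : K) (hr : r ≠ 0) (hN : nsq r a c ≠ 0) (hD : Del r a m ≠ 0) :
    atrchbO r a m c ^ 2 * (1 + atrchbO r a m c ^ 2 / trchbO r a m c ^ 2)
        = atrchbO r a m c ^ 2 * (nsq r a c / r ^ 2) ∧
    atrchbO r a m c ^ 2 * (nsq r a c / r ^ 2) = Z43 r a m c := by
  unfold atrchbO trchbO Z43
  constructor
  · unfold nsq at *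
    field_simp
  · field_simp
    ring

omit [CharZero K] in
/-- `[J]` p.860, `ℜZ₁₃`: the bracket `−a²sin θcos θ/|q|³ + (a cos θ/r)(a r sin θ/|q|³)` vanishes.
[cite: GiorgiKlainermanSzeftel2024, p.860 L92–100; GiorgiKlainermanSzeftel2022, l.35151–35152] -/
theorem ReZ13_bracket (r a c s n : K) (hr : r ≠ 0) :
    -(a ^ 2 * s * c) / n ^ 3 + a * c / r * (a * r * s / n ^ 3) = 0 := by
  field_simp
  ring

omit [CharZero K] in
/-- `[J]` p.860, `ℜZ₂₃ = 8(⁽ᵃ⁾tr χ̲²/tr χ̲)η̲₂ + 4tr χ̲ η̲₂ − 4⁽ᵃ⁾tr χ̲ *η̲₂ = 8a sin θ Δ/|q|⁵` on the outgoing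
Kerr values (the middle display substitutes `⁽ᵃ⁾tr χ̲²/tr χ̲ = (a cos θ/r)(2aΔcos θ/|q|⁴)` etc.).
[cite: GiorgiKlainermanSzeftel2024, p.860 L120–130; GiorgiKlainermanSzeftel2022, l.35155–35158] -/
theorem Z23_kerr (r a m c s n : K) (hn : n ^ 2 = nsq r a c) (hn0 : n ≠ 0) (hr : r ≠ 0)
    (hD : Del r a m ≠ 0) :
    8 * (atrchbO r a m c ^ 2 / trchbO r a m c) * etab2 r a s n + 4 * trchbO r a m c * etab2 r a s n
        - 4 * atrchbO r a m c * setab2 a c s n = Z23 r a m s n ∧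
    8 * (a * c / r) * (2 * a * Del r a m * c / nsq r a c ^ 2) * (a * r * s / n ^ 3)
        + 4 * (2 * r * Del r a m / nsq r a c ^ 2) * (a * r * s / n ^ 3)
        - 4 * (2 * a * Del r a m * c / nsq r a c ^ 2) * (a ^ 2 * s * c / n ^ 3) = Z23 r a m s n := by
  obtain ⟨n3, n4, n5, n6, n7, n8, n9, n10, n11, n12, -⟩ := sqpow n _ hn
  have hN := nsq_ne_zero_of_sq r a c n hn hn0
  unfold atrchbO trchbO etab2 setab2 Z23
  unfold nsq at *
  constructor
  · field_simp
    (try ring_nf); (try simp only [hn]); (try ring_nf)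
  · field_simp
    (try ring_nf); (try simp only [hn]); (try ring_nf)

omit [CharZero K] in
/-- `[J]` p.862: the coefficients of `∇_T∇₃A` and `∇_Z∇₃A` in `L_𝔮[A]`,
`2Z₄₃(r² + a²)/Δ + Z₂₃ a sin θ/|q| = 8a²Δ/(r²|q|⁴)` and `2Z₄₃a/Δ + Z₂₃/(|q| sin θ) = 8aΔ/(r²|q|⁴)`
(these are the coefficients displayed in `[J]` Theorem 5.2.9).
[cite: GiorgiKlainermanSzeftel2024, p.862 L52–89 and Theorem 5.2.9 p.193 L42–45; GiorgiKlainermanSzeftel2022, l.35225–35231, l.8871] -/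
theorem Lq_coefficients (r a m c s n : K) (hn : n ^ 2 = nsq r a c) (hn0 : n ≠ 0) (hr : r ≠ 0)
    (hD : Del r a m ≠ 0) (hs0 : s ≠ 0) (hsc : s ^ 2 + c ^ 2 = 1) :
    2 * Z43 r a m c * (r ^ 2 + a ^ 2) / Del r a m + Z23 r a m s n * (a * s / n)
        = 8 * a ^ 2 * Del r a m / (r ^ 2 * nsq r a c ^ 2) ∧
    2 * Z43 r a m c * a / Del r a m + Z23 r a m s n * (1 / (n * s))
        = 8 * a * Del r a m / (r ^ 2 * nsq r a c ^ 2) := by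
  have hs2 : s ^ 2 = 1 - c ^ 2 := by linear_combination hsc
  obtain ⟨n3, n4, n5, n6, n7, n8, n9, n10, n11, n12, -⟩ := sqpow n _ hn
  have hN := nsq_ne_zero_of_sq r a c n hn hn0
  unfold Z43 Z23
  unfold nsq at *
  constructor
  · field_simp
    (try ring_nf); (try simp only [n6, hs2]); (try ring_nf)
  · field_simp
    (try ring_nf); (try simp only [n6]); (try ring_nf)

/-- `[J]` p.862 L90ff (end of the proof of Theorem D.4.7 / Theorem 5.2.9): "By defining
`V := V₁ + (|q|²/Δ) Z₄₃ = (4/|q|²)(r² − 2mr + 2a²)/r² − (4a²cos²θ/|q|⁶)(r² + 6mr + a²cos²θ)`".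
[cite: GiorgiKlainermanSzeftel2024, p.862 L90–p.863; GiorgiKlainermanSzeftel2022, l.35242–35245] -/
theorem V_eq_V1_add_Z43 (r a m c : K) (hr : r ≠ 0) (hN : nsq r a c ≠ 0) :
    Vpot r a m c = V1pot r a m c + nsq r a c / Del r a m * Z43 r a m c := by
  unfold Vpot V1pot Z43 Del
  unfold nsq at *
  field_simp
  ring

end Identities

end Literature.Geometry.Lorentzian.GiorgiKlainermanSzeftel2022.GRWTransformationAlgebra
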